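import Literature.MathematicalPhysics.QuantumFieldTheory.Balaban1983to89.B14From190LayerSizes
import Literature.MathematicalPhysics.QuantumFieldTheory.Balaban1983to89.B11Ineq190FromProp3

/-!
# `Balaban1983to89.B14From190SectG` — T. Bałaban, *Convergent renormalization expansions for lattice gauge theories*,
# Commun. Math. Phys. **119** (1988) 243–285 [Balaban1988Convergent] = [III]: the four (190)-knittings of §§1, 3 (pp. 250, 266,
# 268, 269) END TO END FROM THE LOCATED LEAVES OF [15] SECT. G — the pair of located hypotheses `(h190, hmv)` of every knit
# SUPPLIED BY NAME from [15] = [Balaban1985Variational] Prop. 9 / (190) as assembled in `B11Ineq190Actual` (r08) through the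
# lattice presentations of `B11Presentation190` (p29)

statement-level skeleton of published theorems with citation tags; proofs where landed; nothing here is a claim
about the Yang–Mills mass gap

CITATION HEADER (lean-in-tree rule 2026-08-18).  T. Bałaban, *Convergent renormalization expansions for lattice gauge
theories*, Commun. Math. Phys. **119**, 243–285 (1988), doi:10.1007/BF01217741, bib `Balaban1988Convergent` (cell paper
B14 = "[III]"; PDF held `paper:balaban1988-cmp119-convergent-renormalization`, pp. 250, 266, 268, 269 = PDF 8, 24, 26, 27).
"[15]" = T. Bałaban, *The variational problem and background fields in renormalization group method for lattice gauge
theories*, Commun. Math. Phys. **102**, 277–309 (1985), bib `Balaban1985Variational` (cell paper B11; Prop. 9 p. 309, (190)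
p. 308, (179)–(180) p. 306, (189) p. 308, Prop. 3 p. 289).  Mega-formalization `lit-balaban`, HOME
`run/shared/lean/pub/lit-balaban/`, unit `lit-balaban-r11` gen 9 (B14 fold owner).

WHAT IS REPRODUCED.  SKELETON rows **B14.Eq3.16–3.19** ((3.19)), **B14.Eq3.21–3.22** (the p. 269 bound on `𝐇^{(k)}`),
**B14.Eq1.18–1.19** (the p. 250 bound), **B14.Claim@265** ((3.7)/(3.8)).  THE PRINT, p. 268: *"By the exponential decay property
(190) [15] the function 𝐇_{k+1,□′} is bounded by B₃exp(−δLM₂R_{k+1})44d²B₃ε_{k+1} ≦ 44d²B₃²(1+β₀)exp(−R_k)ε_k on □′, … (3.18)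
… |V^{(k)}(b)(V^{(k)}_{□′}(b))⁻¹ − 1| < … = δ_k (3.19)"*; p. 266: *"By the exponential decay property (190) [15] we obtain the
estimate |𝐇_{k,□}|, |∇^η_{U_{k+1,□′}}𝐇_{k,□}| ≦ B₃(4δ_k + exp(−δ2M₂R_k)30d²L²B₃(1+β₀)ε_k) … (3.7) … |U_{k,□}(∂p) − 1| < … ≦ ε_kη².
(3.8) Thus χ_k(□) = 1"*; p. 269 (after (3.22)) and p. 250 ((1.18)–(1.19)) likewise (quoted verbatim in `B14Eq322From190`,
`B14Eq119From190`).  [15] (190) p. 308: *"|(δ/δB_ν(y′))𝓗_μ(B,x)|, |∇_x(δ/δB_ν(y′))𝓗_μ(B,x)|, … ≦ O(1)[…]·(L^{j′}η)^{−d}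
exp(−⅛δ₀d(y,y′)) (190) for x ∈ Δ(y), … y ∈ Λ_j, y′ ∈ Λ_{j′}."*; Prop. 9 p. 309: *"The function 𝓗(B) is determined by
Eqs. (174), (175) … It is an analytic function of B … and its functional derivative (182) satisfies the inequalities (190)."*

THE CHAIN, BY NAME (nothing restated, nothing modified).  r11's knits take, per argument field `B`, the PAIR of located
hypotheses `h190 : ∀ t, Ineq190 bB (supSize g box blk) (dH t) C δ₀` ([15] (190) for the derivative functionals, output read
*"for x ∈ Δ(y)"* = `B11SupSize190.supSize`) and `hmv : ∀ s, (∀ t, loc y (dH t B) ≤ s) → loc y 𝐇 ≤ s` (the mean-value reading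
of the decay statement for the FUNCTION `𝐇 = 𝓗(B)`).  r08 g10's `B11Ineq190Actual.ineq190_and_hmv_supSize_sectG`
([15] Sect. G (182)–(190) for the ACTUAL Fréchet derivative `(δ/δB)𝓗` of the (179) chart
`𝓗 = B11Eq183Differentiation.chartH179 𝒢 W D2 H₀ (· − H(D ·)) ε₄`, transported to the lattice by p29 g9's
`B11Presentation190` and with `hmv` from p29's `B11MeanValue190`/`…Chart` via Prop. 9's analyticity) PRODUCES exactly this pair,
for the presented lattice function `x ↦ ev x (𝓗(B))` and the canonical derivative family `dH t = (x ↦ ev x) ∘ D𝓗(tB)`, from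
the located leaves of [15] Sect. G only.  THIS FILE COMPOSES the two, so that in each knit (190) ITSELF and `hmv` are no
longer hypotheses.  For the covariant-derivative size of (3.7) (`B11SeminormSize190.covDerivBlockSize`) the `h190` half is
p29's `B11Presentation190.ineq190_presentation_chartH179` fed with r08's `B11Ineq190Actual.ineq190_sectG_dom`, the `hmv`
half p29's `B11Presentation190.hmv_covDerivBlockSize_chartH179`.  The B14 twin of p29 g9's `B16Ineq123From190.ineq123_sectG`.

WHAT THIS FILE PROVES (kernel-checked, zero `sorry`; theorems only — no `def`, no new `Prop`, no named fact; axioms standard).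
§0 `norm_le_loc_supSize_of_isLoc` — the size↔norm compatibility letter `hBloc` of [15] Sect. G for r11's sup INPUT size on a
   finite bond index set: a field localised in the block `y′` (`IsLoc`) has sup norm `≤` its size at `y′`, provided every
   bond lies in the box of its own block (`i ∈ boxB (blkB i)`).
§1 ABSTRACT INPUT SIZE (the level of `B14From190SupSize`; `bB` a block size on the `B`-space `𝒳` of the scheme):
   `ineq319_lt_lattice_sectG` ((3.19) `< δ_k`), `norm_bH322_le_lattice_sectG` (p. 269), `dev119_le_lattice_sectG` (p. 250),
   `ineq38_lt_lattice_sectG` ((3.8), BOTH output sizes — values and covariant derivatives — presented from the same chart)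
   for `𝐇 := x ↦ ev x (𝓗(B))`, with `h190`, `hmv` (and for (3.8) `h190₀`, `h190₁`, `hmv₀`, `hmv₁`) DISCHARGED.
§2 CONCRETE INPUT SIZE (the level of `B14From190LayerSizes`; `𝒳 := X → 𝔸` on the FINITE bond index set `X` of p29's cube
   tower, `bB := supSize g boxB blkB`, `B :=` p29's (3.17)/(3.6) tower field): `ineq319_lt_layer_sectG`, `norm_bH322_le_layer_sectG`,
   `dev119_le_layer_sectG`, `ineq38_lt_layer_sectG` ((3.8) at print's scale `η = L^{−k}`, the one (3.2) hypothesis sizing the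
   field AND the consumer's plaquette) — in addition the INPUT B-sizes `hm` (p29's `B15LayerSupSize` / `B14ArgField36Lattice`),
   the localisations `hD` (box geometry `hfar`) and the compatibility letter `hBloc` (§0) are discharged.
§3 `ineq319_lt_layer_of_inputs` — §2's (3.19) with the Sect. C letters (`Tm` analytic, `Tm 0 = 0`, differentiability of `D`)
   taken from [15] Proposition 3 via r08's `B11Ineq190FromProp3.ineq190_and_hmv_supSize_of_inputs` (`D := B11Prop3Model.Dfix`).
HONEST SCOPE.  Assembly of landed theorems BY NAME: r11 `B14From190SupSize` (p266115/p267982), `B14From190LayerSizes`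
(p269225); r08 `B11Ineq190Actual` (p304614), `B11Ineq190FromProp3` (p305181); p29 `B11Presentation190` (p303950),
`B11MeanValue190Chart` (p303712), `B15LayerSupSize` (p266738).  What is LEFT as hypothesis in every theorem here, exactly:
(i) r08's located leaves of [15] Sect. G — the regime (117)–(121) `Regime 𝒢 0 W B₀ θ C₄ a₃ j a ε₄`, `W = (δ/δA′)V` analytic on
`‖Y‖ < a₃`, the Sect. C map `Tm = · − H(D ·)` analytic on `‖Y‖ < ε₄ + a` with `Tm 0 = 0` (§§1–2; from Prop. 3's inputs in §3),
the argument field `B` in the domain of (180) (`‖H₀B‖ < a ∧ ‖Δ⁽²⁾H₀B‖ < j`), (189) `h189` on that domain (G-B11-G2, *«We do not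
perform these calculations here»*), the kernel letters of G̃ (`hG`), Δ⁽²⁾H₀ (`hD2H0`), H₀ (`hH0`), H (`hH`), (73) `hDfr`, [3] (2.54)
`htri`, the smallness `q < 1` of (187), the size↔norm compatibility letters `hN` (and `hBloc` in §1); (ii) the presentation
letters — real CLMs `ev x : 𝒴 →L[ℝ] (Fin d → 𝔸)` reading off the bond values at the lattice point `x`, dominated on the box of
`y` by the `𝒴`-size `bN` of (190) (`hev`; for (3.8) also `hev₁` for the covariant-derivative size), print's (115) being a
weighted sup norm; (iii) the knits' own located side conditions verbatim — ONE row sum [3] (2.61) `RowSum g σ c` with `τ ≥ 0`,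
`σ + τ ≤ ⅛δ₀` (fed to r08 at the rate `⅛δ₀` by `RowSum.mono`), the weight `const190·κ_B·c ≤ B₃` of (190)'s explicit constant
`const190 κ_B κ_N κ₃ B_G θ_W c_Δ A₀ A_H θ_𝔇 c` against print's `B₃`, the box/tower GEOMETRY (`hbox`, `hfar`, `hX`, `h15`,
`hgeom`), (2.8)/(2.9) where used, p29's lattice regularity data and the located smallness conditions (`hsmall`, `hc₃`, …).
The words *«and finally Proposition 2 and (181)»* of [15] p. 308 (transport from the base point, G-B11-G2a) are not typed, as in
`B11SectG`.  No lattice object of [15] is constructed: the instantiation of `𝒴` as the space (115) on `T_η` with its coordinate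
functionals is the presentation datum `ev` (p29's `B11MeanValue190Lattice` is the concrete (174) instance).  In §2 the scheme's
`B`-space IS the finite product `X → 𝔸` carrying p29's tower field; the operators `H₀`, `H`, `D`, … on it stay data.  NOT summit
progress.  r11 gen 9 (literature-prover-lit-balaban-r11-g9-0).
-/

noncomputable section

open scoped BigOperators
open NormedSpace

namespace Literature.MathematicalPhysics.QuantumFieldTheory.Balaban1983to89.B14From190SectG

open Literature.MathematicalPhysics.QuantumFieldTheory.Balaban1983to89
open MatrixLog B7Prop1Explicit B7Prop2Explicit B7Prop1Local B7Prop3Flat B7Eq92Concrete B7Eq162General B8Lemma1NonAbelian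
  B8Ineq129 B8Ineq130 B8Ineq165Descent B15Ineq184BlockAxial B15Ineq184Local B8Eq115GaugeFixing B14ArgField36Lattice
  B15LayerLocal B15LayerSupSize
open B6RandomWalk B11SectG B11SupSize190 B11SeminormSize190 B11Eq174Chart B11Eq183Differentiation B11Presentation190 B11Ineq190Actual
  B11Ineq190FromProp3 B11Prop3Model B14Ineq38From190 B14Ineq319From190 B14Eq322From190 B14Eq119From190 B14From190SupSize
  B14From190LayerSizes

variable {d : ℕ}

/-! ## §0 The compatibility letter `hBloc` for the sup input size on a finite bond set -/

section Bloc

variable {g : B6.Geometry} {X : Type} [Fintype X] {E : Type} [NormedAddCommGroup E] [Module ℝ E]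

/-- **The letter `hBloc` of [15] Sect. G for r11's sup size** (`B11Ineq190Actual`: *"norm ≤ local size at the localisation
site on 𝒳"*): on a FINITE index set `X` (so that `X → E` carries the sup norm), if every index lies in the box of its own block
(`i ∈ boxB (blkB i)`), then a field localised in the block `y′` — vanishing off `blkB⁻¹(y′)`, `supSize_isLoc_iff` — has
`‖μ‖ ≤ (supSize g boxB blkB).loc y′ μ = max_{i ∈ boxB y′} ‖μ i‖`. [cite: Balaban1985Variational, (190) p.308, (189) p.308] -/
theorem norm_le_loc_supSize_of_isLoc {boxB : g.Site → Finset X} {blkB : X → g.Site}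
    (hcover : ∀ i, i ∈ boxB (blkB i)) {y' : g.Site} {μ : X → E}
    (hμ : (supSize g boxB blkB : BlockNorm g (X → E)).IsLoc y' μ) :
    ‖μ‖ ≤ (supSize g boxB blkB : BlockNorm g (X → E)).loc y' μ := by
  refine (pi_norm_le_iff_of_nonneg ((supSize g boxB blkB : BlockNorm g (X → E)).loc_nonneg y' μ)).2 fun i => ?_
  by_cases hi : blkB i = y'
  · exact norm_apply_le_loc (hi ▸ hcover i) μ
  · rw [(supSize_isLoc_iff y' μ).1 hμ i hi, norm_zero]
    exact (supSize g boxB blkB : BlockNorm g (X → E)).loc_nonneg y' μ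

end Bloc

/-- The (190) constant `const190 κ_B κ_N κ₃ B_G θ_W c_Δ A₀ A_H θ_𝔇 c` of `B11SectG` is `≥ 0` for non-negative data under the
smallness `q < 1` of (187) (as in p29's `B16Ineq123From190.const190_nonneg`, not imported here). [cite: Balaban1985Variational, (187)–(190) p.308] -/
private theorem const190_nonneg' {κB κN κ₃ BG θW cΔ A₀ AH θD c : ℝ} (hκB : 0 ≤ κB) (hκN : 0 ≤ κN) (hκ₃ : 0 ≤ κ₃)
    (hc : 0 ≤ c) (hBG : 0 ≤ BG) (hθW : 0 ≤ θW) (hcΔ : 0 ≤ cΔ) (hA₀ : 0 ≤ A₀) (hAH : 0 ≤ AH) (hθD : 0 ≤ θD)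
    (hq : qG κ₃ κN BG θW c < 1) : 0 ≤ const190 κB κN κ₃ BG θW cΔ A₀ AH θD c := by
  unfold const190
  have h₁ := constA0_nonneg (cΔ := cΔ) hκ₃ hκN hBG hθW hcΔ hA₀ hc hq
  positivity

/-! ## §1 Abstract input size: the four knits of `B14From190SupSize` with `(h190, hmv)` from [15] Sect. G -/

section SupLevel

variable {𝒳 𝒴 𝒵 : Type} [NormedAddCommGroup 𝒳] [NormedSpace ℂ 𝒳] [NormedAddCommGroup 𝒴] [NormedSpace ℂ 𝒴]
  [NormedAddCommGroup 𝒵] [NormedSpace ℂ 𝒵] [CompleteSpace 𝒳] [CompleteSpace 𝒴] [CompleteSpace 𝒵]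
  {𝒢 : 𝒵 →L[ℂ] 𝒴} {W : 𝒴 → 𝒵} {D2 : 𝒴 →L[ℂ] 𝒵} {H₀ : 𝒳 →L[ℂ] 𝒴} {B₀ θ C₄ a₃ j a ε₄ : ℝ}
  {g : B6.Geometry}

section NormedAlgebra

variable {𝔸 : Type} [NormedRing 𝔸] [NormedAlgebra ℂ 𝔸] [CompleteSpace 𝔸] [NormOneClass 𝔸]

/-- **(3.19) `< δ_k` ON THE LATTICE MODEL, END TO END FROM THE LOCATED LEAVES OF [15] SECT. G** — r11's
`B14From190SupSize.ineq319_lt_lattice_of_ineq190_sup` for the presented chart `𝐇 = x ↦ ev x (𝓗(B))`,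
`𝓗 = chartH179 𝒢 W D2 H₀ (· − H(D ·)) ε₄` ([15] (179)), its hypotheses `h190` ((190) for the derivative functionals) and `hmv`
(mean-value reading) SUPPLIED by r08's `B11Ineq190Actual.ineq190_and_hmv_supSize_sectG` (output read *"for x ∈ Δ(y)"*); the
(190) constant is `B11SectG.const190 …`, explicit.  Remaining: r08's located leaves of Sect. G, the presentation letters, and
the knit's side conditions verbatim (argument field of B-size `≤ 44d²B₃ε_{k+1}` at distance `≥ D`, `δLM₂R_{k+1} ≤ τD`, (2.8)/(2.9),
p29's lattice data, smallness). [cite: Balaban1988Convergent, (3.17)–(3.19) p.268; Balaban1985Variational, Prop. 9 (190) pp.308–309, (179)–(180) p.306] -/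
theorem ineq319_lt_lattice_sectG (Reg : Regime 𝒢 0 W B₀ θ C₄ a₃ j a ε₄) (hWa : AnalyticOnNhd ℂ W {Y : 𝒴 | ‖Y‖ < a₃})
    {D : 𝒴 → 𝒳} (H : 𝒳 →L[ℂ] 𝒴) (hTm : AnalyticOnNhd ℂ (fun Y : 𝒴 => Y - H (D Y)) {Y : 𝒴 | ‖Y‖ < ε₄ + a})
    (hTm0 : (0 : 𝒴) - H (D 0) = 0)
    {B : 𝒳} (hB : ‖H₀ B‖ < a ∧ ‖D2 (H₀ B)‖ < j)
    -- the lattice presentation of the configuration space `𝒴` (bond values at the points of `ℤ^d`)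
    (box : g.Site → Finset (B7Prop1Explicit.Site d)) (blk : B7Prop1Explicit.Site d → g.Site)
    (ev : B7Prop1Explicit.Site d → (𝒴 →L[ℝ] (Fin d → 𝔸)))
    {bB : BlockNorm g 𝒳} {bN : BlockNorm g 𝒴} {b3 : BlockNorm g 𝒵}
    (hev : ∀ (y : g.Site) (v : 𝒴), ∀ x ∈ box y, ‖ev x v‖ ≤ bN.loc y v)
    (hN : ∀ (y : g.Site) (v : 𝒴), bN.loc y v ≤ ‖v‖) (hBloc : ∀ (y' : g.Site) (μ : 𝒳), bB.IsLoc y' μ → ‖μ‖ ≤ bB.loc y' μ)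
    -- the located leaves of [15] Sect. G (r08's letters)
    {δ₀ BG θW cΔ A₀ AH θD c : ℝ}
    (htri : Triangle254 g) (hd : ∀ a b : g.Site, 0 ≤ g.dist a b) (hδ₀ : 0 ≤ δ₀)
    (hc : 0 ≤ c) (hBG : 0 ≤ BG) (hθW : 0 ≤ θW) (hcΔ : 0 ≤ cΔ) (hA₀ : 0 ≤ A₀) (hAH : 0 ≤ AH) (hθD : 0 ≤ θD)
    (hG : HasMaj b3 bN (𝒢.restrictScalars ℝ : 𝒵 →ₗ[ℝ] 𝒴) (fun y y' => BG * Real.exp (-(δ₀ * g.dist y y'))))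
    (hD2H0 : HasMaj bB b3 ((D2 ∘L H₀).restrictScalars ℝ : 𝒳 →ₗ[ℝ] 𝒵) (fun y y' => cΔ * Real.exp (-(δ₀ * g.dist y y'))))
    (hH0 : HasMaj bB bN (H₀.restrictScalars ℝ : 𝒳 →ₗ[ℝ] 𝒴) (fun y y' => A₀ * Real.exp (-(δ₀ * g.dist y y'))))
    (hH : HasMaj bB bN (H.restrictScalars ℝ : 𝒳 →ₗ[ℝ] 𝒴) (fun y y' => AH * Real.exp (-(δ₀ / 2 * g.dist y y'))))
    (h189 : ∀ B' : 𝒳, ‖H₀ B'‖ < a → ‖D2 (H₀ B')‖ < j →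
      Ineq189 bN b3 ((fderiv ℂ W (solA180 𝒢 W D2 H₀ ε₄ B' + H₀ B')).restrictScalars ℝ : 𝒴 →ₗ[ℝ] 𝒵) θW δ₀)
    (hDfr : ∀ B' : 𝒳, ‖H₀ B'‖ < a → ‖D2 (H₀ B')‖ < j →
      ∃ 𝔇 : 𝒴 →L[ℂ] 𝒳, HasFDerivAt D 𝔇 (solA180 𝒢 W D2 H₀ ε₄ B' + H₀ B') ∧
        HasMaj bN bB (𝔇.restrictScalars ℝ : 𝒴 →ₗ[ℝ] 𝒳) (fun y y' => θD * Real.exp (-(δ₀ / 2 * g.dist y y'))))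
    (hq : qG b3.κ bN.κ BG θW c < 1)
    -- the [III] side: the letters of `B14From190SupSize.ineq319_lt_lattice_of_ineq190_sup` minus `h190`, `hmv`
    {σ τ Dd : ℝ} (hrow : RowSum g σ c) (hτ : 0 ≤ τ) (hστ : σ + τ ≤ δ₀ / 8) (y : g.Site)
    {B₃ δ M₂ R1 R β₀ A₀' A₁ ε εk1 δk : ℝ}
    (hm : ∀ y', bB.loc y' B ≤ 44 * (d : ℝ) ^ 2 * B₃ * εk1) (hD : ∀ y', bB.loc y' B ≠ 0 → Dd ≤ g.dist y y')
    {Hf : B7Prop1Explicit.Site d → Fin d → 𝔸}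
    (hHf : Hf = fun x => ev x (chartH179 𝒢 W D2 H₀ (fun Y : 𝒴 => Y - H (D Y)) ε₄ B))
    {L : ℕ} (hL : 2 ≤ L) {G : Subgroup 𝔸ˣ} (hAG : AvgClosed d L G) {k : ℕ}
    {U₀ : B7Prop1Explicit.Site d → Fin d → 𝔸ˣ} (hU₀ : ∀ x κ, U₀ x κ ∈ G) {α₀ : ℝ} (hα : 0 < α₀)
    (hα3 : C0 d * α₀ ≤ 1 / 3) (hα4 : 4 * α₀ ≤ c2' d L) (h52 : pdev U₀ < α₀ * (((L : ℝ) ^ k)⁻¹) ^ 2)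
    (q : B7Prop1Explicit.Site d) (κ : Fin d)
    (hgeom : δ * L * M₂ * R1 ≤ τ * Dd)
    (hCB : const190 bB.κ bN.κ b3.κ BG θW cΔ A₀ AH θD c * bB.κ * c ≤ B₃) (hB₃ : 0 ≤ B₃)
    (hε1 : 0 ≤ εk1) (hflow : εk1 ≤ (1 + β₀) * ε) (hRR : R ≤ δ * L * M₂ * R1)
    (hbox : ∀ y', B7Prop1Local.InBox (B7Prop1Local.loK L k q) (B7Prop1Local.bondHiK L k q κ) y' → y' ∈ box y)
    (hβ₀ : 0 ≤ 1 + β₀) (hε : 0 ≤ ε) (hδk : 0 < δk) (hεδ : ε = A₀' / A₁ * δk)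
    (hsmall : Real.exp (4 * (800 * ((d : ℝ) + 1) ^ 2 * ((d : ℝ) + 4)) * α₀)
      * (1 + 8 * (131072 * ((d : ℝ) + 1) ^ 2) * (44 * (d : ℝ) ^ 2 * B₃ ^ 2 * (1 + β₀) * Real.exp (-R) * ε)) ≤ 2)
    (hc₃ : 2 * (44 * (d : ℝ) ^ 2 * B₃ ^ 2 * (1 + β₀) * Real.exp (-R) * ε) ≤ c3 d L)
    (hsm : 2048 * (d : ℝ) * (44 * (d : ℝ) ^ 2 * B₃ ^ 2 * (1 + β₀) * Real.exp (-R) * ε) ≤ 1)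
    (h1 : 128 * (44 * (d : ℝ) ^ 2 * B₃ ^ 2 * (1 + β₀) * Real.exp (-R) * ε) ≤ 1)
    (hgk : (68 * ((d : ℝ) + 1) + 160 * d) * 44 * (d : ℝ) ^ 2 * B₃ ^ 2 * (1 + β₀) * (A₀' / A₁) * Real.exp (-R) < 1)
    (hL1 : 1 ≤ L) :
    ‖((avgIter L
          (gaugeAct (B7Eq84Concrete.glev L hL1 U₀
              (expCfg (fun z μ => ((Complex.I : ℂ) * ((((L : ℝ) ^ (k + 1))⁻¹ : ℝ) : ℂ)) • Hf z μ)) k 0)⁻¹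
            (expCfg (fun z μ => ((Complex.I : ℂ) * ((((L : ℝ) ^ (k + 1))⁻¹ : ℝ) : ℂ)) • Hf z μ) * U₀)) k q κ : 𝔸ˣ) : 𝔸)
        * (((avgIter L U₀ k q κ)⁻¹ : 𝔸ˣ) : 𝔸) - 1‖ < δk := by
  have hrow8 : RowSum g (δ₀ / 8) c := hrow.mono hd (by linarith)
  have hK : 0 ≤ const190 bB.κ bN.κ b3.κ BG θW cΔ A₀ AH θD c :=
    const190_nonneg' bB.κ_nonneg bN.κ_nonneg b3.κ_nonneg hc hBG hθW hcΔ hA₀ hAH hθD hq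
  obtain ⟨h190, hmv⟩ := ineq190_and_hmv_supSize_sectG (box := box) (blk := blk) Reg hWa H hTm hTm0 hB ev hev hN hBloc htri
    hd hδ₀ hrow8 hc hBG hθW hcΔ hA₀ hAH hθD hG hD2H0 hH0 hH h189 hDfr hq
    (fun B' => fun x => ev x (chartH179 𝒢 W D2 H₀ (fun Y : 𝒴 => Y - H (D Y)) ε₄ B'))
    (fun t => (LinearMap.pi fun x => ((ev x : 𝒴 →L[ℝ] (Fin d → 𝔸)) : 𝒴 →ₗ[ℝ] (Fin d → 𝔸))) ∘ₗ
      ((fderiv ℂ (chartH179 𝒢 W D2 H₀ (fun Y : 𝒴 => Y - H (D Y)) ε₄) ((t : ℝ) • B)).restrictScalars ℝ : 𝒳 →ₗ[ℝ] 𝒴))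
    (fun _ => rfl) (fun _ => rfl) y
  subst hHf
  exact ineq319_lt_lattice_of_ineq190_sup box blk h190 hK hd hrow hτ hστ B y hm hD hmv hL hAG hU₀ hα hα3 hα4 h52 q κ
    hgeom hCB hB₃ hε1 hflow hRR hbox hβ₀ hε hδk hεδ hsmall hc₃ hsm h1 hgk hL1

/-- **p. 269, the bound on `𝐇^{(k)}` ON THE LATTICE MODEL, END TO END FROM THE LOCATED LEAVES OF [15] SECT. G** — r11's
`B14From190SupSize.norm_bH322_le_lattice_of_ineq190_sup` for the presented chart `𝐇 = x ↦ ev x (𝓗(B))`, with `h190`, `hmv`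
SUPPLIED by r08's `B11Ineq190Actual.ineq190_and_hmv_supSize_sectG`.
[cite: Balaban1988Convergent, (3.22) p.269, (3.17)–(3.18) p.268; Balaban1985Variational, Prop. 9 (190) pp.308–309, (179)–(180) p.306] -/
theorem norm_bH322_le_lattice_sectG (Reg : Regime 𝒢 0 W B₀ θ C₄ a₃ j a ε₄) (hWa : AnalyticOnNhd ℂ W {Y : 𝒴 | ‖Y‖ < a₃})
    {D : 𝒴 → 𝒳} (H : 𝒳 →L[ℂ] 𝒴) (hTm : AnalyticOnNhd ℂ (fun Y : 𝒴 => Y - H (D Y)) {Y : 𝒴 | ‖Y‖ < ε₄ + a})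
    (hTm0 : (0 : 𝒴) - H (D 0) = 0)
    {B : 𝒳} (hB : ‖H₀ B‖ < a ∧ ‖D2 (H₀ B)‖ < j)
    (box : g.Site → Finset (B7Prop1Explicit.Site d)) (blk : B7Prop1Explicit.Site d → g.Site)
    (ev : B7Prop1Explicit.Site d → (𝒴 →L[ℝ] (Fin d → 𝔸)))
    {bB : BlockNorm g 𝒳} {bN : BlockNorm g 𝒴} {b3 : BlockNorm g 𝒵}
    (hev : ∀ (y : g.Site) (v : 𝒴), ∀ x ∈ box y, ‖ev x v‖ ≤ bN.loc y v)
    (hN : ∀ (y : g.Site) (v : 𝒴), bN.loc y v ≤ ‖v‖) (hBloc : ∀ (y' : g.Site) (μ : 𝒳), bB.IsLoc y' μ → ‖μ‖ ≤ bB.loc y' μ)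
    {δ₀ BG θW cΔ A₀ AH θD c : ℝ}
    (htri : Triangle254 g) (hd : ∀ a b : g.Site, 0 ≤ g.dist a b) (hδ₀ : 0 ≤ δ₀)
    (hc : 0 ≤ c) (hBG : 0 ≤ BG) (hθW : 0 ≤ θW) (hcΔ : 0 ≤ cΔ) (hA₀ : 0 ≤ A₀) (hAH : 0 ≤ AH) (hθD : 0 ≤ θD)
    (hG : HasMaj b3 bN (𝒢.restrictScalars ℝ : 𝒵 →ₗ[ℝ] 𝒴) (fun y y' => BG * Real.exp (-(δ₀ * g.dist y y'))))
    (hD2H0 : HasMaj bB b3 ((D2 ∘L H₀).restrictScalars ℝ : 𝒳 →ₗ[ℝ] 𝒵) (fun y y' => cΔ * Real.exp (-(δ₀ * g.dist y y'))))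
    (hH0 : HasMaj bB bN (H₀.restrictScalars ℝ : 𝒳 →ₗ[ℝ] 𝒴) (fun y y' => A₀ * Real.exp (-(δ₀ * g.dist y y'))))
    (hH : HasMaj bB bN (H.restrictScalars ℝ : 𝒳 →ₗ[ℝ] 𝒴) (fun y y' => AH * Real.exp (-(δ₀ / 2 * g.dist y y'))))
    (h189 : ∀ B' : 𝒳, ‖H₀ B'‖ < a → ‖D2 (H₀ B')‖ < j →
      Ineq189 bN b3 ((fderiv ℂ W (solA180 𝒢 W D2 H₀ ε₄ B' + H₀ B')).restrictScalars ℝ : 𝒴 →ₗ[ℝ] 𝒵) θW δ₀)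
    (hDfr : ∀ B' : 𝒳, ‖H₀ B'‖ < a → ‖D2 (H₀ B')‖ < j →
      ∃ 𝔇 : 𝒴 →L[ℂ] 𝒳, HasFDerivAt D 𝔇 (solA180 𝒢 W D2 H₀ ε₄ B' + H₀ B') ∧
        HasMaj bN bB (𝔇.restrictScalars ℝ : 𝒴 →ₗ[ℝ] 𝒳) (fun y y' => θD * Real.exp (-(δ₀ / 2 * g.dist y y'))))
    (hq : qG b3.κ bN.κ BG θW c < 1)
    -- the [III] side: the letters of `B14From190SupSize.norm_bH322_le_lattice_of_ineq190_sup` minus `h190`, `hmv`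
    {σ τ Dd : ℝ} (hrow : RowSum g σ c) (hτ : 0 ≤ τ) (hστ : σ + τ ≤ δ₀ / 8) (y : g.Site)
    {B₃ δ M₂ R1 R β₀ ε εk1 : ℝ}
    (hm : ∀ y', bB.loc y' B ≤ 44 * (d : ℝ) ^ 2 * B₃ * εk1) (hD : ∀ y', bB.loc y' B ≠ 0 → Dd ≤ g.dist y y')
    {Hf : B7Prop1Explicit.Site d → Fin d → 𝔸}
    (hHf : Hf = fun x => ev x (chartH179 𝒢 W D2 H₀ (fun Y : 𝒴 => Y - H (D Y)) ε₄ B))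
    {L : ℕ} (hL : 2 ≤ L) {G : Subgroup 𝔸ˣ} (hAG : AvgClosed d L G) {k : ℕ}
    {U₀ : B7Prop1Explicit.Site d → Fin d → 𝔸ˣ} (hU₀ : ∀ x κ, U₀ x κ ∈ G) {α₀ : ℝ} (hα : 0 < α₀)
    (hα3 : C0 d * α₀ ≤ 1 / 3) (hα4 : 4 * α₀ ≤ c2' d L) (h52 : pdev U₀ < α₀ * (((L : ℝ) ^ k)⁻¹) ^ 2)
    (q : B7Prop1Explicit.Site d) (κ : Fin d)
    (hgeom : δ * L * M₂ * R1 ≤ τ * Dd)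
    (hCB : const190 bB.κ bN.κ b3.κ BG θW cΔ A₀ AH θD c * bB.κ * c ≤ B₃) (hB₃ : 0 ≤ B₃)
    (hε1 : 0 ≤ εk1) (hflow : εk1 ≤ (1 + β₀) * ε) (hRR : R ≤ δ * L * M₂ * R1)
    (hbox : ∀ y', B7Prop1Local.InBox (B7Prop1Local.loK L k q) (B7Prop1Local.bondHiK L k q κ) y' → y' ∈ box y)
    (hβ₀ : 0 ≤ 1 + β₀) (hε : 0 ≤ ε)
    (hsmall : Real.exp (4 * (800 * ((d : ℝ) + 1) ^ 2 * ((d : ℝ) + 4)) * α₀)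
      * (1 + 8 * (131072 * ((d : ℝ) + 1) ^ 2) * (44 * (d : ℝ) ^ 2 * B₃ ^ 2 * (1 + β₀) * Real.exp (-R) * ε)) ≤ 2)
    (hc₃ : 2 * (44 * (d : ℝ) ^ 2 * B₃ ^ 2 * (1 + β₀) * Real.exp (-R) * ε) ≤ c3 d L)
    (hsm : 2048 * (d : ℝ) * (44 * (d : ℝ) ^ 2 * B₃ ^ 2 * (1 + β₀) * Real.exp (-R) * ε) ≤ 1)
    (h1 : 128 * (44 * (d : ℝ) ^ 2 * B₃ ^ 2 * (1 + β₀) * Real.exp (-R) * ε) ≤ 1) (hL1 : 1 ≤ L)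
    (hs : (68 * ((d : ℝ) + 1) + 160 * d) * 44 * (d : ℝ) ^ 2 * B₃ ^ 2 * (1 + β₀) * ε * Real.exp (-R) ≤ 1 / 2) :
    ‖B14.Eq316.bH (avgIter L
          (gaugeAct (B7Eq84Concrete.glev L hL1 U₀
              (expCfg (fun z μ => ((Complex.I : ℂ) * ((((L : ℝ) ^ (k + 1))⁻¹ : ℝ) : ℂ)) • Hf z μ)) k 0)⁻¹
            (expCfg (fun z μ => ((Complex.I : ℂ) * ((((L : ℝ) ^ (k + 1))⁻¹ : ℝ) : ℂ)) • Hf z μ) * U₀)) k q κ)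
        (avgIter L U₀ k q κ)‖
      ≤ 2 * ((68 * ((d : ℝ) + 1) + 160 * d) * 44 * (d : ℝ) ^ 2 * B₃ ^ 2 * (1 + β₀)) * ε * Real.exp (-R) := by
  have hrow8 : RowSum g (δ₀ / 8) c := hrow.mono hd (by linarith)
  have hK : 0 ≤ const190 bB.κ bN.κ b3.κ BG θW cΔ A₀ AH θD c :=
    const190_nonneg' bB.κ_nonneg bN.κ_nonneg b3.κ_nonneg hc hBG hθW hcΔ hA₀ hAH hθD hq
  obtain ⟨h190, hmv⟩ := ineq190_and_hmv_supSize_sectG (box := box) (blk := blk) Reg hWa H hTm hTm0 hB ev hev hN hBloc htri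
    hd hδ₀ hrow8 hc hBG hθW hcΔ hA₀ hAH hθD hG hD2H0 hH0 hH h189 hDfr hq
    (fun B' => fun x => ev x (chartH179 𝒢 W D2 H₀ (fun Y : 𝒴 => Y - H (D Y)) ε₄ B'))
    (fun t => (LinearMap.pi fun x => ((ev x : 𝒴 →L[ℝ] (Fin d → 𝔸)) : 𝒴 →ₗ[ℝ] (Fin d → 𝔸))) ∘ₗ
      ((fderiv ℂ (chartH179 𝒢 W D2 H₀ (fun Y : 𝒴 => Y - H (D Y)) ε₄) ((t : ℝ) • B)).restrictScalars ℝ : 𝒳 →ₗ[ℝ] 𝒴))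
    (fun _ => rfl) (fun _ => rfl) y
  subst hHf
  exact norm_bH322_le_lattice_of_ineq190_sup box blk h190 hK hd hrow hτ hστ B y hm hD hmv hL hAG hU₀ hα hα3 hα4 h52 q κ
    hgeom hCB hB₃ hε1 hflow hRR hbox hβ₀ hε hsmall hc₃ hsm h1 hL1 hs

/-- **p. 250, `|U₁U_{1,□′}⁻¹ − 1| ≤ O(1)B₃e^{−δLM₂R₁}·44d²B₃ε₁` ON THE LATTICE MODEL, END TO END FROM THE LOCATED LEAVES OF [15]
SECT. G** — r11's `B14From190SupSize.dev119_le_lattice_of_ineq190_sup` (`k = 0`) for the presented chart `𝐇 = x ↦ ev x (𝓗(B))`,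
with `h190`, `hmv` SUPPLIED by r08's `B11Ineq190Actual.ineq190_and_hmv_supSize_sectG`.
[cite: Balaban1988Convergent, (1.18)–(1.19) p.250; Balaban1985Variational, Prop. 9 (190) pp.308–309, (179)–(180) p.306] -/
theorem dev119_le_lattice_sectG (Reg : Regime 𝒢 0 W B₀ θ C₄ a₃ j a ε₄) (hWa : AnalyticOnNhd ℂ W {Y : 𝒴 | ‖Y‖ < a₃})
    {D : 𝒴 → 𝒳} (H : 𝒳 →L[ℂ] 𝒴) (hTm : AnalyticOnNhd ℂ (fun Y : 𝒴 => Y - H (D Y)) {Y : 𝒴 | ‖Y‖ < ε₄ + a})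
    (hTm0 : (0 : 𝒴) - H (D 0) = 0)
    {B : 𝒳} (hB : ‖H₀ B‖ < a ∧ ‖D2 (H₀ B)‖ < j)
    (box : g.Site → Finset (B7Prop1Explicit.Site d)) (blk : B7Prop1Explicit.Site d → g.Site)
    (ev : B7Prop1Explicit.Site d → (𝒴 →L[ℝ] (Fin d → 𝔸)))
    {bB : BlockNorm g 𝒳} {bN : BlockNorm g 𝒴} {b3 : BlockNorm g 𝒵}
    (hev : ∀ (y : g.Site) (v : 𝒴), ∀ x ∈ box y, ‖ev x v‖ ≤ bN.loc y v)
    (hN : ∀ (y : g.Site) (v : 𝒴), bN.loc y v ≤ ‖v‖) (hBloc : ∀ (y' : g.Site) (μ : 𝒳), bB.IsLoc y' μ → ‖μ‖ ≤ bB.loc y' μ)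
    {δ₀ BG θW cΔ A₀ AH θD c : ℝ}
    (htri : Triangle254 g) (hd : ∀ a b : g.Site, 0 ≤ g.dist a b) (hδ₀ : 0 ≤ δ₀)
    (hc : 0 ≤ c) (hBG : 0 ≤ BG) (hθW : 0 ≤ θW) (hcΔ : 0 ≤ cΔ) (hA₀ : 0 ≤ A₀) (hAH : 0 ≤ AH) (hθD : 0 ≤ θD)
    (hG : HasMaj b3 bN (𝒢.restrictScalars ℝ : 𝒵 →ₗ[ℝ] 𝒴) (fun y y' => BG * Real.exp (-(δ₀ * g.dist y y'))))
    (hD2H0 : HasMaj bB b3 ((D2 ∘L H₀).restrictScalars ℝ : 𝒳 →ₗ[ℝ] 𝒵) (fun y y' => cΔ * Real.exp (-(δ₀ * g.dist y y'))))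
    (hH0 : HasMaj bB bN (H₀.restrictScalars ℝ : 𝒳 →ₗ[ℝ] 𝒴) (fun y y' => A₀ * Real.exp (-(δ₀ * g.dist y y'))))
    (hH : HasMaj bB bN (H.restrictScalars ℝ : 𝒳 →ₗ[ℝ] 𝒴) (fun y y' => AH * Real.exp (-(δ₀ / 2 * g.dist y y'))))
    (h189 : ∀ B' : 𝒳, ‖H₀ B'‖ < a → ‖D2 (H₀ B')‖ < j →
      Ineq189 bN b3 ((fderiv ℂ W (solA180 𝒢 W D2 H₀ ε₄ B' + H₀ B')).restrictScalars ℝ : 𝒴 →ₗ[ℝ] 𝒵) θW δ₀)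
    (hDfr : ∀ B' : 𝒳, ‖H₀ B'‖ < a → ‖D2 (H₀ B')‖ < j →
      ∃ 𝔇 : 𝒴 →L[ℂ] 𝒳, HasFDerivAt D 𝔇 (solA180 𝒢 W D2 H₀ ε₄ B' + H₀ B') ∧
        HasMaj bN bB (𝔇.restrictScalars ℝ : 𝒴 →ₗ[ℝ] 𝒳) (fun y y' => θD * Real.exp (-(δ₀ / 2 * g.dist y y'))))
    (hq : qG b3.κ bN.κ BG θW c < 1)
    -- the [III] side: the letters of `B14From190SupSize.dev119_le_lattice_of_ineq190_sup` minus `h190`, `hmv`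
    {σ τ Dd : ℝ} (hrow : RowSum g σ c) (hτ : 0 ≤ τ) (hστ : σ + τ ≤ δ₀ / 8) (y : g.Site)
    {B₃ δ M₂ R₁ ε₁ : ℝ}
    (hm : ∀ y', bB.loc y' B ≤ 44 * (d : ℝ) ^ 2 * B₃ * ε₁) (hD : ∀ y', bB.loc y' B ≠ 0 → Dd ≤ g.dist y y')
    {Hf : B7Prop1Explicit.Site d → Fin d → 𝔸}
    (hHf : Hf = fun x => ev x (chartH179 𝒢 W D2 H₀ (fun Y : 𝒴 => Y - H (D Y)) ε₄ B))
    {L : ℕ} (hL : 2 ≤ L) {G : Subgroup 𝔸ˣ} (hAG : AvgClosed d L G)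
    {U₀ : B7Prop1Explicit.Site d → Fin d → 𝔸ˣ} (hU₀ : ∀ x κ, U₀ x κ ∈ G) {α₀ : ℝ} (hα : 0 < α₀)
    (hα3 : C0 d * α₀ ≤ 1 / 3) (hα4 : 4 * α₀ ≤ c2' d L) (h52 : pdev U₀ < α₀ * (((L : ℝ) ^ 0)⁻¹) ^ 2)
    (q : B7Prop1Explicit.Site d) (κ : Fin d)
    (hgeom : δ * L * M₂ * R₁ ≤ τ * Dd)
    (hCB : const190 bB.κ bN.κ b3.κ BG θW cΔ A₀ AH θD c * bB.κ * c ≤ B₃) (hB₃ : 0 ≤ B₃)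
    (hbox : ∀ y', B7Prop1Local.InBox (B7Prop1Local.loK L 0 q) (B7Prop1Local.bondHiK L 0 q κ) y' → y' ∈ box y)
    (hsmall : Real.exp (4 * (800 * ((d : ℝ) + 1) ^ 2 * ((d : ℝ) + 4)) * α₀)
      * (1 + 8 * (131072 * ((d : ℝ) + 1) ^ 2) * (B₃ * Real.exp (-(δ * L * M₂ * R₁)) * (44 * (d : ℝ) ^ 2 * B₃) * ε₁)) ≤ 2)
    (hc₃ : 2 * (B₃ * Real.exp (-(δ * L * M₂ * R₁)) * (44 * (d : ℝ) ^ 2 * B₃) * ε₁) ≤ c3 d L)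
    (hsm : 2048 * (d : ℝ) * (B₃ * Real.exp (-(δ * L * M₂ * R₁)) * (44 * (d : ℝ) ^ 2 * B₃) * ε₁) ≤ 1)
    (h1 : 128 * (B₃ * Real.exp (-(δ * L * M₂ * R₁)) * (44 * (d : ℝ) ^ 2 * B₃) * ε₁) ≤ 1) (hL1 : 1 ≤ L) :
    ‖((avgIter L
          (gaugeAct (B7Eq84Concrete.glev L hL1 U₀
              (expCfg (fun z μ => ((Complex.I : ℂ) * ((((L : ℝ) ^ (0 + 1))⁻¹ : ℝ) : ℂ)) • Hf z μ)) 0 0)⁻¹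
            (expCfg (fun z μ => ((Complex.I : ℂ) * ((((L : ℝ) ^ (0 + 1))⁻¹ : ℝ) : ℂ)) • Hf z μ) * U₀)) 0 q κ : 𝔸ˣ) : 𝔸)
        * (((avgIter L U₀ 0 q κ)⁻¹ : 𝔸ˣ) : 𝔸) - 1‖
      ≤ (68 * ((d : ℝ) + 1) + 160 * d) * (B₃ * Real.exp (-(δ * L * M₂ * R₁)) * (44 * (d : ℝ) ^ 2 * B₃) * ε₁) := by
  have hrow8 : RowSum g (δ₀ / 8) c := hrow.mono hd (by linarith)
  have hK : 0 ≤ const190 bB.κ bN.κ b3.κ BG θW cΔ A₀ AH θD c :=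
    const190_nonneg' bB.κ_nonneg bN.κ_nonneg b3.κ_nonneg hc hBG hθW hcΔ hA₀ hAH hθD hq
  obtain ⟨h190, hmv⟩ := ineq190_and_hmv_supSize_sectG (box := box) (blk := blk) Reg hWa H hTm hTm0 hB ev hev hN hBloc htri
    hd hδ₀ hrow8 hc hBG hθW hcΔ hA₀ hAH hθD hG hD2H0 hH0 hH h189 hDfr hq
    (fun B' => fun x => ev x (chartH179 𝒢 W D2 H₀ (fun Y : 𝒴 => Y - H (D Y)) ε₄ B'))
    (fun t => (LinearMap.pi fun x => ((ev x : 𝒴 →L[ℝ] (Fin d → 𝔸)) : 𝒴 →ₗ[ℝ] (Fin d → 𝔸))) ∘ₗ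
      ((fderiv ℂ (chartH179 𝒢 W D2 H₀ (fun Y : 𝒴 => Y - H (D Y)) ε₄) ((t : ℝ) • B)).restrictScalars ℝ : 𝒳 →ₗ[ℝ] 𝒴))
    (fun _ => rfl) (fun _ => rfl) y
  subst hHf
  exact dev119_le_lattice_of_ineq190_sup box blk h190 hK hd hrow hτ hστ B y hm hD hmv hL hAG hU₀ hα hα3 hα4 h52 q κ
    hgeom hCB hB₃ hbox hsmall hc₃ hsm h1 hL1

end NormedAlgebra

section CStar

variable {𝔸 : Type} [CStarAlgebra 𝔸] [Nontrivial 𝔸]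

/-- **(3.8) ⇒ "Thus χ_k(□) = 1" ON THE LATTICE MODEL, END TO END FROM THE LOCATED LEAVES OF [15] SECT. G** — r11's
`B14From190SupSize.ineq38_lt_lattice_of_ineq190_sizes` (output sizes `supSize gB box blk` — *"sup_{x∈Δ(y)}|𝐇_{k,□}|"* — and
`covDerivBlockSize gB y₀ S η U₀` — *"sup_{x∈Δ(y)}|∇^η_{U_{k+1,□′}}𝐇_{k,□}|"*) for the presented chart `𝐇 = x ↦ ev x (𝓗(B₁ + B₂))`:
its FOUR located hypotheses `h190₀`/`hmv₀` (values: r08's `B11Ineq190Actual.ineq190_and_hmv_supSize_sectG`) and `h190₁`/`hmv₁`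
(covariant derivatives: p29's `B11Presentation190.ineq190_presentation_chartH179` fed with r08's `B11Ineq190Actual.ineq190_sectG_dom`,
and `B11Presentation190.hmv_covDerivBlockSize_chartH179`) SUPPLIED; the two entries n = 0, 1 of (190) are read off ONE `𝒴`-size
`bN` through the two compatibility letters `hev` (values) and `hev₁` (the covariant-derivative size of the presented function is
dominated by `bN` — print's (115) norm carries the first covariant derivatives).  Remaining as in §1 plus the knit's (3.8) side
conditions verbatim (the split argument field `B₁ + B₂` of B-sizes `4δ_k` / `30d²L²B₃(1+β₀)ε_k`, the latter at distance `≥ D`,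
`2δM₂R_k ≤ τD`, *"for A₁/A₀ and γ sufficiently small"* as `h10`, the plaquette data).
[cite: Balaban1988Convergent, (3.6)–(3.8) p.266; Balaban1985Variational, Prop. 9 (190) pp.308–309, (179)–(180) p.306, (115) p.294] -/
theorem ineq38_lt_lattice_sectG (Reg : Regime 𝒢 0 W B₀ θ C₄ a₃ j a ε₄) (hWa : AnalyticOnNhd ℂ W {Y : 𝒴 | ‖Y‖ < a₃})
    {D : 𝒴 → 𝒳} (H : 𝒳 →L[ℂ] 𝒴) (hTm : AnalyticOnNhd ℂ (fun Y : 𝒴 => Y - H (D Y)) {Y : 𝒴 | ‖Y‖ < ε₄ + a})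
    (hTm0 : (0 : 𝒴) - H (D 0) = 0)
    {B₁ B₂ : 𝒳} (hB : ‖H₀ (B₁ + B₂)‖ < a ∧ ‖D2 (H₀ (B₁ + B₂))‖ < j)
    {gB : B6.Geometry} (box : gB.Site → Finset (B7Prop1Explicit.Site d)) (blk : B7Prop1Explicit.Site d → gB.Site)
    (y₀ : gB.Site) (S : gB.Site → Finset (B7Prop1Explicit.Site d × Fin d × Fin d))
    {η : ℝ} {U₀ : B7Prop1Explicit.Site d → Fin d → 𝔸ˣ}
    (ev : B7Prop1Explicit.Site d → (𝒴 →L[ℝ] (Fin d → 𝔸)))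
    {bB : BlockNorm gB 𝒳} {bN : BlockNorm gB 𝒴} {b3 : BlockNorm gB 𝒵}
    (hev : ∀ (y : gB.Site) (v : 𝒴), ∀ x ∈ box y, ‖ev x v‖ ≤ bN.loc y v)
    (hev₁ : ∀ (y : gB.Site) (v : 𝒴), (covDerivBlockSize gB y₀ S η U₀).loc y (fun x => ev x v) ≤ bN.loc y v)
    (hN : ∀ (y : gB.Site) (v : 𝒴), bN.loc y v ≤ ‖v‖) (hBloc : ∀ (y' : gB.Site) (μ : 𝒳), bB.IsLoc y' μ → ‖μ‖ ≤ bB.loc y' μ)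
    {δ₀ BG θW cΔ A₀ AH θD c : ℝ}
    (htri : Triangle254 gB) (hd : ∀ a b : gB.Site, 0 ≤ gB.dist a b) (hδ₀ : 0 ≤ δ₀)
    (hc : 0 ≤ c) (hBG : 0 ≤ BG) (hθW : 0 ≤ θW) (hcΔ : 0 ≤ cΔ) (hA₀ : 0 ≤ A₀) (hAH : 0 ≤ AH) (hθD : 0 ≤ θD)
    (hG : HasMaj b3 bN (𝒢.restrictScalars ℝ : 𝒵 →ₗ[ℝ] 𝒴) (fun y y' => BG * Real.exp (-(δ₀ * gB.dist y y'))))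
    (hD2H0 : HasMaj bB b3 ((D2 ∘L H₀).restrictScalars ℝ : 𝒳 →ₗ[ℝ] 𝒵) (fun y y' => cΔ * Real.exp (-(δ₀ * gB.dist y y'))))
    (hH0 : HasMaj bB bN (H₀.restrictScalars ℝ : 𝒳 →ₗ[ℝ] 𝒴) (fun y y' => A₀ * Real.exp (-(δ₀ * gB.dist y y'))))
    (hH : HasMaj bB bN (H.restrictScalars ℝ : 𝒳 →ₗ[ℝ] 𝒴) (fun y y' => AH * Real.exp (-(δ₀ / 2 * gB.dist y y'))))
    (h189 : ∀ B' : 𝒳, ‖H₀ B'‖ < a → ‖D2 (H₀ B')‖ < j →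
      Ineq189 bN b3 ((fderiv ℂ W (solA180 𝒢 W D2 H₀ ε₄ B' + H₀ B')).restrictScalars ℝ : 𝒴 →ₗ[ℝ] 𝒵) θW δ₀)
    (hDfr : ∀ B' : 𝒳, ‖H₀ B'‖ < a → ‖D2 (H₀ B')‖ < j →
      ∃ 𝔇 : 𝒴 →L[ℂ] 𝒳, HasFDerivAt D 𝔇 (solA180 𝒢 W D2 H₀ ε₄ B' + H₀ B') ∧
        HasMaj bN bB (𝔇.restrictScalars ℝ : 𝒴 →ₗ[ℝ] 𝒳) (fun y y' => θD * Real.exp (-(δ₀ / 2 * gB.dist y y'))))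
    (hq : qG b3.κ bN.κ BG θW c < 1)
    -- the [III] side: the letters of `B14From190SupSize.ineq38_lt_lattice_of_ineq190_sizes` minus `h190₀,₁`, `hmv₀,₁`
    {σ τ Dd B₃ δ M₂ R δk β₀ A₀' A₁ : ℝ} (hrow : RowSum gB σ c) (hτ : 0 ≤ τ) (hστ : σ + τ ≤ δ₀ / 8) (y : gB.Site)
    (hη : 0 < η) (hη1 : η ≤ 1) (h₀ : ∀ z κ, U₀ z κ ∈ U1 𝔸)
    {Hf : B7Prop1Explicit.Site d → Fin d → 𝔸}
    (hHf : Hf = fun x => ev x (chartH179 𝒢 W D2 H₀ (fun Y : 𝒴 => Y - H (D Y)) ε₄ (B₁ + B₂)))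
    (hsa : ∀ z κ, IsSelfAdjoint (Hf z κ))
    {u : B7Prop1Explicit.Site d → 𝔸ˣ} (hu : ∀ z, u z ∈ U1 𝔸) (μ ν : Fin d) (x : B7Prop1Explicit.Site d)
    {εk εk1 L : ℝ}
    (hm₁ : ∀ y', bB.loc y' B₁ ≤ 4 * δk)
    (hm₂ : ∀ y', bB.loc y' B₂ ≤ 30 * (d : ℝ) ^ 2 * L ^ 2 * B₃ * (1 + β₀) * εk)
    (hD₂ : ∀ y', bB.loc y' B₂ ≠ 0 → Dd ≤ gB.dist y y')
    (hgeom : 2 * δ * M₂ * R ≤ τ * Dd) (hCB : const190 bB.κ bN.κ b3.κ BG θW cΔ A₀ AH θD c * bB.κ * c ≤ B₃) (hB₃ : 0 ≤ B₃)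
    (hβ : 0 ≤ 1 + β₀) (hδkε : δk = A₁ / A₀' * εk) (hM : 1 ≤ 2 * δ * M₂) (hR : 0 ≤ R)
    (h10 : 4 * B₃ * A₁ / A₀' + 30 * (d : ℝ) ^ 2 * L ^ 2 * B₃ ^ 2 * (1 + β₀) * Real.exp (-R) < 1/10)
    (hx : x ∈ box y) (hxμ : x + e μ ∈ box y) (hxν : x + e ν ∈ box y)
    (hS₁ : (x, μ, ν) ∈ S y) (hS₂ : (x, ν, μ) ∈ S y)
    (hε : 0 < εk) (hε1 : εk ≤ 1) (hL : 0 < L) (hε' : 0 < εk1) (hflow : εk1 ≤ (1 + β₀) * εk)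
    (hrestr : 2 * (1 + β₀) * L⁻¹ ^ 2 + 4/10 < 1)
    (hdev₀ : ‖B8Ineq132.plaqF U₀ μ ν x - 1‖ < εk1 * (L⁻¹ * η) ^ 2) :
    ‖B8Ineq132.plaqF (gaugeAct u (B8Lemma1NonAbelian.mulCfg (B8Eq146AExpansion.expCfg
        (B8Eq146AExpansion.iEta η Hf)) U₀)) μ ν x - 1‖ < εk * η ^ 2 := by
  have hrow8 : RowSum gB (δ₀ / 8) c := hrow.mono hd (by linarith)
  have hK : 0 ≤ const190 bB.κ bN.κ b3.κ BG θW cΔ A₀ AH θD c :=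
    const190_nonneg' bB.κ_nonneg bN.κ_nonneg b3.κ_nonneg hc hBG hθW hcΔ hA₀ hAH hθD hq
  -- values: r08's end-to-end pair
  obtain ⟨h190₀, hmv₀⟩ := ineq190_and_hmv_supSize_sectG (box := box) (blk := blk) Reg hWa H hTm hTm0 hB ev hev hN hBloc htri
    hd hδ₀ hrow8 hc hBG hθW hcΔ hA₀ hAH hθD hG hD2H0 hH0 hH h189 hDfr hq
    (fun B' => fun x => ev x (chartH179 𝒢 W D2 H₀ (fun Y : 𝒴 => Y - H (D Y)) ε₄ B'))
    (fun t => (LinearMap.pi fun x => ((ev x : 𝒴 →L[ℝ] (Fin d → 𝔸)) : 𝒴 →ₗ[ℝ] (Fin d → 𝔸))) ∘ₗ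
      ((fderiv ℂ (chartH179 𝒢 W D2 H₀ (fun Y : 𝒴 => Y - H (D Y)) ε₄) ((t : ℝ) • (B₁ + B₂))).restrictScalars ℝ :
        𝒳 →ₗ[ℝ] 𝒴))
    (fun _ => rfl) (fun _ => rfl) y
  -- covariant derivatives: (190) on `𝒴` on the domain of (180) (r08), presented into the first-order size (p29), and `hmv₁` (p29)
  have h190Y := ineq190_sectG_dom Reg hWa H hN hBloc htri hd hδ₀ hrow8 hc hBG hθW hcΔ hA₀ hAH hθD hG hD2H0 hH0 hH h189 hDfr hq
  have h190₁ := ineq190_presentation_chartH179 (b₃ := covDerivBlockSize gB y₀ S η U₀) hB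
    (LinearMap.pi fun x => ((ev x : 𝒴 →L[ℝ] (Fin d → 𝔸)) : 𝒴 →ₗ[ℝ] (Fin d → 𝔸))) (fun y' v => hev₁ y' v) h190Y
    (fun t => (LinearMap.pi fun x => ((ev x : 𝒴 →L[ℝ] (Fin d → 𝔸)) : 𝒴 →ₗ[ℝ] (Fin d → 𝔸))) ∘ₗ
      ((fderiv ℂ (chartH179 𝒢 W D2 H₀ (fun Y : 𝒴 => Y - H (D Y)) ε₄) ((t : ℝ) • (B₁ + B₂))).restrictScalars ℝ :
        𝒳 →ₗ[ℝ] 𝒴))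
    (fun _ => rfl)
  have hmv₁ := hmv_covDerivBlockSize_chartH179 (y₀ := y₀) (S := S) (ξ := η) (U₀ := U₀) Reg hWa hTm hTm0 ev
    (fun B' => fun x => ev x (chartH179 𝒢 W D2 H₀ (fun Y : 𝒴 => Y - H (D Y)) ε₄ B'))
    (fun t => (LinearMap.pi fun x => ((ev x : 𝒴 →L[ℝ] (Fin d → 𝔸)) : 𝒴 →ₗ[ℝ] (Fin d → 𝔸))) ∘ₗ
      ((fderiv ℂ (chartH179 𝒢 W D2 H₀ (fun Y : 𝒴 => Y - H (D Y)) ε₄) ((t : ℝ) • (B₁ + B₂))).restrictScalars ℝ :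
        𝒳 →ₗ[ℝ] 𝒴))
    hB (fun _ => rfl) (fun _ _ => rfl) y
  subst hHf
  exact ineq38_lt_lattice_of_ineq190_sizes box blk y₀ S h190₀ h190₁ hK hd hrow hτ hστ y hη hη1 h₀ hsa hu μ ν x hm₁ hm₂
    hD₂ hmv₀ hmv₁ hgeom hCB hB₃ hβ hδkε hM hR h10 hx hxμ hxν hS₁ hS₂ hε hε1 hL hε' hflow hrestr hdev₀

end CStar

end SupLevel

/-! ## §2 Concrete input size: the four knits of `B14From190LayerSizes` with `(h190, hmv)` from [15] Sect. G

Here the scheme's `B`-space IS the finite product `X → 𝔸` over the bond index set `X` of p29's cube tower (sup norm), the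
input size is r11's `supSize g boxB blkB` (so `κ_B = 1` and `hBloc` is §0), and the argument field `B` is p29's tower field;
`hm`, `hD` are discharged inside `B14From190LayerSizes` (p29's `B15LayerSupSize`, box geometry). -/

section LayerLevel

variable {X : Type} [Fintype X]
variable {𝒴 𝒵 : Type} [NormedAddCommGroup 𝒴] [NormedSpace ℂ 𝒴] [NormedAddCommGroup 𝒵] [NormedSpace ℂ 𝒵]
  [CompleteSpace 𝒴] [CompleteSpace 𝒵] {g : B6.Geometry}

section NormedAlgebra

variable {𝔸 : Type} [NormedRing 𝔸] [NormedAlgebra ℂ 𝔸] [CompleteSpace 𝔸] [NormOneClass 𝔸]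
  {𝒢 : 𝒵 →L[ℂ] 𝒴} {W : 𝒴 → 𝒵} {D2 : 𝒴 →L[ℂ] 𝒵} {H₀ : (X → 𝔸) →L[ℂ] 𝒴} {B₀ θ C₄ a₃ j a ε₄ : ℝ}

/-- **(3.19) `< δ_k`, END TO END FROM [15] SECT. G WITH INPUT AND OUTPUT SIZES CONCRETE** — r11's
`B14From190LayerSizes.ineq319_lt_of_ineq190_layer` (argument field `B :=` p29's (3.17) tower field
`i ↦ (1/i)log[M^{K−j}(U₀)(b_i)((Q^{s*}_jM^K(U₀))(b_i))⁻¹]` on the finite bond set `X`, input size `supSize g boxB blkB`, B-size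
`44d²B₃ε_{k+1}` and localisation discharged there) for the presented chart `𝐇 = x ↦ ev x (𝓗(B))`, with `h190`, `hmv` SUPPLIED by
r08's `B11Ineq190Actual.ineq190_and_hmv_supSize_sectG` on the `B`-space `X → 𝔸` and `hBloc` by §0 (`i ∈ boxB (blkB i)`).
[cite: Balaban1988Convergent, (3.17)–(3.19) p.268; Balaban1985Variational, Prop. 9 (190) pp.308–309, (179)–(180) p.306] -/
theorem ineq319_lt_layer_sectG (Reg : Regime 𝒢 0 W B₀ θ C₄ a₃ j a ε₄) (hWa : AnalyticOnNhd ℂ W {Y : 𝒴 | ‖Y‖ < a₃})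
    {D : 𝒴 → X → 𝔸} (H : (X → 𝔸) →L[ℂ] 𝒴) (hTm : AnalyticOnNhd ℂ (fun Y : 𝒴 => Y - H (D Y)) {Y : 𝒴 | ‖Y‖ < ε₄ + a})
    (hTm0 : (0 : 𝒴) - H (D 0) = 0)
    -- p29's (3.17) tower and its field `B`, which must lie in the domain of (180)
    (dep : X → ℕ) (pt : X → B7Prop1Explicit.Site d) (dir : X → Fin d)
    {L : ℕ} (hL : 2 ≤ L) (hd1 : 1 ≤ d) {G : Subgroup 𝔸ˣ} (hAG : AvgClosed d L G) (K : ℕ)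
    {U₀ : B7Prop1Explicit.Site d → Fin d → 𝔸ˣ} (hU₀ : ∀ x κ, U₀ x κ ∈ G)
    (hB : ‖H₀ (fun i => mlog (((avgIter L U₀ (K - dep i) (pt i) (dir i) *
          (pullIter L (avgIter L U₀ K) (dep i) (pt i) (dir i))⁻¹ : 𝔸ˣ) : 𝔸)))‖ < a ∧
      ‖D2 (H₀ (fun i => mlog (((avgIter L U₀ (K - dep i) (pt i) (dir i) *
          (pullIter L (avgIter L U₀ K) (dep i) (pt i) (dir i))⁻¹ : 𝔸ˣ) : 𝔸))))‖ < j)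
    -- sizes and presentation
    (boxB : g.Site → Finset X) (blkB : X → g.Site) (hcover : ∀ i, i ∈ boxB (blkB i))
    (box : g.Site → Finset (B7Prop1Explicit.Site d)) (blk : B7Prop1Explicit.Site d → g.Site)
    (ev : B7Prop1Explicit.Site d → (𝒴 →L[ℝ] (Fin d → 𝔸)))
    {bN : BlockNorm g 𝒴} {b3 : BlockNorm g 𝒵}
    (hev : ∀ (y : g.Site) (v : 𝒴), ∀ x ∈ box y, ‖ev x v‖ ≤ bN.loc y v)
    (hN : ∀ (y : g.Site) (v : 𝒴), bN.loc y v ≤ ‖v‖)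
    -- the located leaves of [15] Sect. G (r08's letters), input size `supSize g boxB blkB`
    {δ₀ BG θW cΔ A₀ AH θD c : ℝ}
    (htri : Triangle254 g) (hd : ∀ a b : g.Site, 0 ≤ g.dist a b) (hδ₀ : 0 ≤ δ₀)
    (hc : 0 ≤ c) (hBG : 0 ≤ BG) (hθW : 0 ≤ θW) (hcΔ : 0 ≤ cΔ) (hA₀ : 0 ≤ A₀) (hAH : 0 ≤ AH) (hθD : 0 ≤ θD)
    (hG : HasMaj b3 bN (𝒢.restrictScalars ℝ : 𝒵 →ₗ[ℝ] 𝒴) (fun y y' => BG * Real.exp (-(δ₀ * g.dist y y'))))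
    (hD2H0 : HasMaj (supSize (X := X) (E := 𝔸) g boxB blkB) b3 ((D2 ∘L H₀).restrictScalars ℝ : (X → 𝔸) →ₗ[ℝ] 𝒵)
      (fun y y' => cΔ * Real.exp (-(δ₀ * g.dist y y'))))
    (hH0 : HasMaj (supSize (X := X) (E := 𝔸) g boxB blkB) bN (H₀.restrictScalars ℝ : (X → 𝔸) →ₗ[ℝ] 𝒴)
      (fun y y' => A₀ * Real.exp (-(δ₀ * g.dist y y'))))
    (hH : HasMaj (supSize (X := X) (E := 𝔸) g boxB blkB) bN (H.restrictScalars ℝ : (X → 𝔸) →ₗ[ℝ] 𝒴)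
      (fun y y' => AH * Real.exp (-(δ₀ / 2 * g.dist y y'))))
    (h189 : ∀ B' : X → 𝔸, ‖H₀ B'‖ < a → ‖D2 (H₀ B')‖ < j →
      Ineq189 bN b3 ((fderiv ℂ W (solA180 𝒢 W D2 H₀ ε₄ B' + H₀ B')).restrictScalars ℝ : 𝒴 →ₗ[ℝ] 𝒵) θW δ₀)
    (hDfr : ∀ B' : X → 𝔸, ‖H₀ B'‖ < a → ‖D2 (H₀ B')‖ < j →
      ∃ 𝔇 : 𝒴 →L[ℂ] (X → 𝔸), HasFDerivAt D 𝔇 (solA180 𝒢 W D2 H₀ ε₄ B' + H₀ B') ∧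
        HasMaj bN (supSize (X := X) (E := 𝔸) g boxB blkB) (𝔇.restrictScalars ℝ : 𝒴 →ₗ[ℝ] (X → 𝔸))
          (fun y y' => θD * Real.exp (-(δ₀ / 2 * g.dist y y'))))
    (hq : qG b3.κ bN.κ BG θW c < 1)
    -- the [III] side: the letters of `B14From190LayerSizes.ineq319_lt_of_ineq190_layer` minus `h190`, `hmv`
    {σ τ Dd : ℝ} (hrow : RowSum g σ c) (hτ : 0 ≤ τ) (hστ : σ + τ ≤ δ₀ / 8) (y : g.Site)
    {B₃ δ M₂ R1 R β₀ A₀' A₁ ε εk1 δk : ℝ} (hB₃ : 0 < B₃) (hε1 : 0 < εk1)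
    (hs3 : C0 d * (2 * B₃ * εk1) ≤ 1 / 3) (hs2 : 2 * (2 * B₃ * εk1) ≤ c2' d L)
    (hs : 11 * (d : ℝ) ^ 2 * (2 * B₃ * εk1) ≤ 1 / 6) (lo hi : B7Prop1Explicit.Site d) (hlohi : lo ≤ hi)
    (h317 : pdevOn (tlo L lo K) (thi L hi K) U₀ < 2 * B₃ * εk1 * (((L : ℝ) ^ K)⁻¹) ^ 2)
    (h15 : ∀ n, n < K → ∀ z, tlo L lo n ≤ z → z ≤ thi L hi n → ∀ r : Fin d → Fin L,
      axialFn (avgIter L U₀ (K - (n + 1))) ((L : ℤ) • z) ((L : ℤ) • z + boxVec L r) = 1)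
    (hX : ∀ i, dep i ≤ K ∧ tlo L lo (dep i) ≤ pt i ∧ pt i + e (dir i) ≤ thi L hi (dep i))
    (hfar : ∀ y' i, i ∈ boxB y' → Dd ≤ g.dist y y')
    {Hf : B7Prop1Explicit.Site d → Fin d → 𝔸}
    (hHf : Hf = fun x => ev x (chartH179 𝒢 W D2 H₀ (fun Y : 𝒴 => Y - H (D Y)) ε₄
      (fun i => mlog (((avgIter L U₀ (K - dep i) (pt i) (dir i) *
          (pullIter L (avgIter L U₀ K) (dep i) (pt i) (dir i))⁻¹ : 𝔸ˣ) : 𝔸)))))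
    {k : ℕ} {α₀ : ℝ} (hα : 0 < α₀)
    (hα3 : C0 d * α₀ ≤ 1 / 3) (hα4 : 4 * α₀ ≤ c2' d L) (h52 : pdev U₀ < α₀ * (((L : ℝ) ^ k)⁻¹) ^ 2)
    (q : B7Prop1Explicit.Site d) (κ : Fin d)
    (hgeom : δ * L * M₂ * R1 ≤ τ * Dd) (hCB : const190 1 bN.κ b3.κ BG θW cΔ A₀ AH θD c * c ≤ B₃)
    (hflow : εk1 ≤ (1 + β₀) * ε) (hRR : R ≤ δ * L * M₂ * R1)
    (hbox : ∀ y', B7Prop1Local.InBox (B7Prop1Local.loK L k q) (B7Prop1Local.bondHiK L k q κ) y' → y' ∈ box y)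
    (hβ₀ : 0 ≤ 1 + β₀) (hε : 0 ≤ ε) (hδk : 0 < δk) (hεδ : ε = A₀' / A₁ * δk)
    (hsmall : Real.exp (4 * (800 * ((d : ℝ) + 1) ^ 2 * ((d : ℝ) + 4)) * α₀)
      * (1 + 8 * (131072 * ((d : ℝ) + 1) ^ 2) * (44 * (d : ℝ) ^ 2 * B₃ ^ 2 * (1 + β₀) * Real.exp (-R) * ε)) ≤ 2)
    (hc₃ : 2 * (44 * (d : ℝ) ^ 2 * B₃ ^ 2 * (1 + β₀) * Real.exp (-R) * ε) ≤ c3 d L)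
    (hsm : 2048 * (d : ℝ) * (44 * (d : ℝ) ^ 2 * B₃ ^ 2 * (1 + β₀) * Real.exp (-R) * ε) ≤ 1)
    (h1 : 128 * (44 * (d : ℝ) ^ 2 * B₃ ^ 2 * (1 + β₀) * Real.exp (-R) * ε) ≤ 1)
    (hgk : (68 * ((d : ℝ) + 1) + 160 * d) * 44 * (d : ℝ) ^ 2 * B₃ ^ 2 * (1 + β₀) * (A₀' / A₁) * Real.exp (-R) < 1)
    (hL1 : 1 ≤ L) :
    ‖((avgIter L
          (gaugeAct (B7Eq84Concrete.glev L hL1 U₀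
              (expCfg (fun z μ => ((Complex.I : ℂ) * ((((L : ℝ) ^ (k + 1))⁻¹ : ℝ) : ℂ)) • Hf z μ)) k 0)⁻¹
            (expCfg (fun z μ => ((Complex.I : ℂ) * ((((L : ℝ) ^ (k + 1))⁻¹ : ℝ) : ℂ)) • Hf z μ) * U₀)) k q κ : 𝔸ˣ) : 𝔸)
        * (((avgIter L U₀ k q κ)⁻¹ : 𝔸ˣ) : 𝔸) - 1‖ < δk := by
  have hrow8 : RowSum g (δ₀ / 8) c := hrow.mono hd (by linarith)
  have hK : 0 ≤ const190 1 bN.κ b3.κ BG θW cΔ A₀ AH θD c :=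
    const190_nonneg' zero_le_one bN.κ_nonneg b3.κ_nonneg hc hBG hθW hcΔ hA₀ hAH hθD hq
  have hBloc : ∀ (y' : g.Site) (μ : X → 𝔸), (supSize (X := X) (E := 𝔸) g boxB blkB).IsLoc y' μ →
      ‖μ‖ ≤ (supSize (X := X) (E := 𝔸) g boxB blkB).loc y' μ := fun y' μ hμ => norm_le_loc_supSize_of_isLoc hcover hμ
  obtain ⟨h190, hmv⟩ := ineq190_and_hmv_supSize_sectG (box := box) (blk := blk) Reg hWa H hTm hTm0 hB ev hev hN hBloc htri
    hd hδ₀ hrow8 hc hBG hθW hcΔ hA₀ hAH hθD hG hD2H0 hH0 hH h189 hDfr hq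
    (fun B' => fun x => ev x (chartH179 𝒢 W D2 H₀ (fun Y : 𝒴 => Y - H (D Y)) ε₄ B'))
    (fun t => (LinearMap.pi fun x => ((ev x : 𝒴 →L[ℝ] (Fin d → 𝔸)) : 𝒴 →ₗ[ℝ] (Fin d → 𝔸))) ∘ₗ
      ((fderiv ℂ (chartH179 𝒢 W D2 H₀ (fun Y : 𝒴 => Y - H (D Y)) ε₄) ((t : ℝ) •
        (fun i => mlog (((avgIter L U₀ (K - dep i) (pt i) (dir i) *
          (pullIter L (avgIter L U₀ K) (dep i) (pt i) (dir i))⁻¹ : 𝔸ˣ) : 𝔸))))).restrictScalars ℝ : (X → 𝔸) →ₗ[ℝ] 𝒴))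
    (fun _ => rfl) (fun _ => rfl) y
  subst hHf
  rw [supSize_κ] at h190
  exact ineq319_lt_of_ineq190_layer boxB blkB dep pt dir box blk h190 hK hd hrow hτ hστ y hL hd1 hAG K hU₀ hB₃ hε1 hs3 hs2
    hs lo hi hlohi h317 h15 hX hfar hmv hα hα3 hα4 h52 q κ hgeom hCB hflow hRR hbox hβ₀ hε hδk hεδ hsmall hc₃ hsm h1 hgk hL1

/-- **p. 269, the bound on `𝐇^{(k)}`, END TO END FROM [15] SECT. G WITH INPUT AND OUTPUT SIZES CONCRETE** — r11's
`B14From190LayerSizes.norm_bH322_le_of_ineq190_layer` for the presented chart at p29's (3.17) tower field, with `h190`, `hmv`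
SUPPLIED by r08's `B11Ineq190Actual.ineq190_and_hmv_supSize_sectG` on `X → 𝔸`, `hBloc` by §0.
[cite: Balaban1988Convergent, (3.22) p.269, (3.17) p.268; Balaban1985Variational, Prop. 9 (190) pp.308–309, (179)–(180) p.306] -/
theorem norm_bH322_le_layer_sectG (Reg : Regime 𝒢 0 W B₀ θ C₄ a₃ j a ε₄) (hWa : AnalyticOnNhd ℂ W {Y : 𝒴 | ‖Y‖ < a₃})
    {D : 𝒴 → X → 𝔸} (H : (X → 𝔸) →L[ℂ] 𝒴) (hTm : AnalyticOnNhd ℂ (fun Y : 𝒴 => Y - H (D Y)) {Y : 𝒴 | ‖Y‖ < ε₄ + a})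
    (hTm0 : (0 : 𝒴) - H (D 0) = 0)
    (dep : X → ℕ) (pt : X → B7Prop1Explicit.Site d) (dir : X → Fin d)
    {L : ℕ} (hL : 2 ≤ L) (hd1 : 1 ≤ d) {G : Subgroup 𝔸ˣ} (hAG : AvgClosed d L G) (K : ℕ)
    {U₀ : B7Prop1Explicit.Site d → Fin d → 𝔸ˣ} (hU₀ : ∀ x κ, U₀ x κ ∈ G)
    (hB : ‖H₀ (fun i => mlog (((avgIter L U₀ (K - dep i) (pt i) (dir i) *
          (pullIter L (avgIter L U₀ K) (dep i) (pt i) (dir i))⁻¹ : 𝔸ˣ) : 𝔸)))‖ < a ∧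
      ‖D2 (H₀ (fun i => mlog (((avgIter L U₀ (K - dep i) (pt i) (dir i) *
          (pullIter L (avgIter L U₀ K) (dep i) (pt i) (dir i))⁻¹ : 𝔸ˣ) : 𝔸))))‖ < j)
    (boxB : g.Site → Finset X) (blkB : X → g.Site) (hcover : ∀ i, i ∈ boxB (blkB i))
    (box : g.Site → Finset (B7Prop1Explicit.Site d)) (blk : B7Prop1Explicit.Site d → g.Site)
    (ev : B7Prop1Explicit.Site d → (𝒴 →L[ℝ] (Fin d → 𝔸)))
    {bN : BlockNorm g 𝒴} {b3 : BlockNorm g 𝒵}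
    (hev : ∀ (y : g.Site) (v : 𝒴), ∀ x ∈ box y, ‖ev x v‖ ≤ bN.loc y v)
    (hN : ∀ (y : g.Site) (v : 𝒴), bN.loc y v ≤ ‖v‖)
    {δ₀ BG θW cΔ A₀ AH θD c : ℝ}
    (htri : Triangle254 g) (hd : ∀ a b : g.Site, 0 ≤ g.dist a b) (hδ₀ : 0 ≤ δ₀)
    (hc : 0 ≤ c) (hBG : 0 ≤ BG) (hθW : 0 ≤ θW) (hcΔ : 0 ≤ cΔ) (hA₀ : 0 ≤ A₀) (hAH : 0 ≤ AH) (hθD : 0 ≤ θD)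
    (hG : HasMaj b3 bN (𝒢.restrictScalars ℝ : 𝒵 →ₗ[ℝ] 𝒴) (fun y y' => BG * Real.exp (-(δ₀ * g.dist y y'))))
    (hD2H0 : HasMaj (supSize (X := X) (E := 𝔸) g boxB blkB) b3 ((D2 ∘L H₀).restrictScalars ℝ : (X → 𝔸) →ₗ[ℝ] 𝒵)
      (fun y y' => cΔ * Real.exp (-(δ₀ * g.dist y y'))))
    (hH0 : HasMaj (supSize (X := X) (E := 𝔸) g boxB blkB) bN (H₀.restrictScalars ℝ : (X → 𝔸) →ₗ[ℝ] 𝒴)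
      (fun y y' => A₀ * Real.exp (-(δ₀ * g.dist y y'))))
    (hH : HasMaj (supSize (X := X) (E := 𝔸) g boxB blkB) bN (H.restrictScalars ℝ : (X → 𝔸) →ₗ[ℝ] 𝒴)
      (fun y y' => AH * Real.exp (-(δ₀ / 2 * g.dist y y'))))
    (h189 : ∀ B' : X → 𝔸, ‖H₀ B'‖ < a → ‖D2 (H₀ B')‖ < j →
      Ineq189 bN b3 ((fderiv ℂ W (solA180 𝒢 W D2 H₀ ε₄ B' + H₀ B')).restrictScalars ℝ : 𝒴 →ₗ[ℝ] 𝒵) θW δ₀)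
    (hDfr : ∀ B' : X → 𝔸, ‖H₀ B'‖ < a → ‖D2 (H₀ B')‖ < j →
      ∃ 𝔇 : 𝒴 →L[ℂ] (X → 𝔸), HasFDerivAt D 𝔇 (solA180 𝒢 W D2 H₀ ε₄ B' + H₀ B') ∧
        HasMaj bN (supSize (X := X) (E := 𝔸) g boxB blkB) (𝔇.restrictScalars ℝ : 𝒴 →ₗ[ℝ] (X → 𝔸))
          (fun y y' => θD * Real.exp (-(δ₀ / 2 * g.dist y y'))))
    (hq : qG b3.κ bN.κ BG θW c < 1)
    -- the [III] side: the letters of `B14From190LayerSizes.norm_bH322_le_of_ineq190_layer` minus `h190`, `hmv`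
    {σ τ Dd : ℝ} (hrow : RowSum g σ c) (hτ : 0 ≤ τ) (hστ : σ + τ ≤ δ₀ / 8) (y : g.Site)
    {B₃ δ M₂ R1 R β₀ ε εk1 : ℝ} (hB₃ : 0 < B₃) (hε1 : 0 < εk1)
    (hs3 : C0 d * (2 * B₃ * εk1) ≤ 1 / 3) (hs2 : 2 * (2 * B₃ * εk1) ≤ c2' d L)
    (hs : 11 * (d : ℝ) ^ 2 * (2 * B₃ * εk1) ≤ 1 / 6) (lo hi : B7Prop1Explicit.Site d) (hlohi : lo ≤ hi)
    (h317 : pdevOn (tlo L lo K) (thi L hi K) U₀ < 2 * B₃ * εk1 * (((L : ℝ) ^ K)⁻¹) ^ 2)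
    (h15 : ∀ n, n < K → ∀ z, tlo L lo n ≤ z → z ≤ thi L hi n → ∀ r : Fin d → Fin L,
      axialFn (avgIter L U₀ (K - (n + 1))) ((L : ℤ) • z) ((L : ℤ) • z + boxVec L r) = 1)
    (hX : ∀ i, dep i ≤ K ∧ tlo L lo (dep i) ≤ pt i ∧ pt i + e (dir i) ≤ thi L hi (dep i))
    (hfar : ∀ y' i, i ∈ boxB y' → Dd ≤ g.dist y y')
    {Hf : B7Prop1Explicit.Site d → Fin d → 𝔸}
    (hHf : Hf = fun x => ev x (chartH179 𝒢 W D2 H₀ (fun Y : 𝒴 => Y - H (D Y)) ε₄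
      (fun i => mlog (((avgIter L U₀ (K - dep i) (pt i) (dir i) *
          (pullIter L (avgIter L U₀ K) (dep i) (pt i) (dir i))⁻¹ : 𝔸ˣ) : 𝔸)))))
    {k : ℕ} {α₀ : ℝ} (hα : 0 < α₀)
    (hα3 : C0 d * α₀ ≤ 1 / 3) (hα4 : 4 * α₀ ≤ c2' d L) (h52 : pdev U₀ < α₀ * (((L : ℝ) ^ k)⁻¹) ^ 2)
    (q : B7Prop1Explicit.Site d) (κ : Fin d)
    (hgeom : δ * L * M₂ * R1 ≤ τ * Dd) (hCB : const190 1 bN.κ b3.κ BG θW cΔ A₀ AH θD c * c ≤ B₃)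
    (hflow : εk1 ≤ (1 + β₀) * ε) (hRR : R ≤ δ * L * M₂ * R1)
    (hbox : ∀ y', B7Prop1Local.InBox (B7Prop1Local.loK L k q) (B7Prop1Local.bondHiK L k q κ) y' → y' ∈ box y)
    (hβ₀ : 0 ≤ 1 + β₀) (hε : 0 ≤ ε)
    (hsmall : Real.exp (4 * (800 * ((d : ℝ) + 1) ^ 2 * ((d : ℝ) + 4)) * α₀)
      * (1 + 8 * (131072 * ((d : ℝ) + 1) ^ 2) * (44 * (d : ℝ) ^ 2 * B₃ ^ 2 * (1 + β₀) * Real.exp (-R) * ε)) ≤ 2)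
    (hc₃ : 2 * (44 * (d : ℝ) ^ 2 * B₃ ^ 2 * (1 + β₀) * Real.exp (-R) * ε) ≤ c3 d L)
    (hsm : 2048 * (d : ℝ) * (44 * (d : ℝ) ^ 2 * B₃ ^ 2 * (1 + β₀) * Real.exp (-R) * ε) ≤ 1)
    (h1 : 128 * (44 * (d : ℝ) ^ 2 * B₃ ^ 2 * (1 + β₀) * Real.exp (-R) * ε) ≤ 1) (hL1 : 1 ≤ L)
    (hsO : (68 * ((d : ℝ) + 1) + 160 * d) * 44 * (d : ℝ) ^ 2 * B₃ ^ 2 * (1 + β₀) * ε * Real.exp (-R) ≤ 1 / 2) :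
    ‖B14.Eq316.bH (avgIter L
          (gaugeAct (B7Eq84Concrete.glev L hL1 U₀
              (expCfg (fun z μ => ((Complex.I : ℂ) * ((((L : ℝ) ^ (k + 1))⁻¹ : ℝ) : ℂ)) • Hf z μ)) k 0)⁻¹
            (expCfg (fun z μ => ((Complex.I : ℂ) * ((((L : ℝ) ^ (k + 1))⁻¹ : ℝ) : ℂ)) • Hf z μ) * U₀)) k q κ)
        (avgIter L U₀ k q κ)‖
      ≤ 2 * ((68 * ((d : ℝ) + 1) + 160 * d) * 44 * (d : ℝ) ^ 2 * B₃ ^ 2 * (1 + β₀)) * ε * Real.exp (-R) := by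
  have hrow8 : RowSum g (δ₀ / 8) c := hrow.mono hd (by linarith)
  have hK : 0 ≤ const190 1 bN.κ b3.κ BG θW cΔ A₀ AH θD c :=
    const190_nonneg' zero_le_one bN.κ_nonneg b3.κ_nonneg hc hBG hθW hcΔ hA₀ hAH hθD hq
  have hBloc : ∀ (y' : g.Site) (μ : X → 𝔸), (supSize (X := X) (E := 𝔸) g boxB blkB).IsLoc y' μ →
      ‖μ‖ ≤ (supSize (X := X) (E := 𝔸) g boxB blkB).loc y' μ := fun y' μ hμ => norm_le_loc_supSize_of_isLoc hcover hμ
  obtain ⟨h190, hmv⟩ := ineq190_and_hmv_supSize_sectG (box := box) (blk := blk) Reg hWa H hTm hTm0 hB ev hev hN hBloc htri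
    hd hδ₀ hrow8 hc hBG hθW hcΔ hA₀ hAH hθD hG hD2H0 hH0 hH h189 hDfr hq
    (fun B' => fun x => ev x (chartH179 𝒢 W D2 H₀ (fun Y : 𝒴 => Y - H (D Y)) ε₄ B'))
    (fun t => (LinearMap.pi fun x => ((ev x : 𝒴 →L[ℝ] (Fin d → 𝔸)) : 𝒴 →ₗ[ℝ] (Fin d → 𝔸))) ∘ₗ
      ((fderiv ℂ (chartH179 𝒢 W D2 H₀ (fun Y : 𝒴 => Y - H (D Y)) ε₄) ((t : ℝ) •
        (fun i => mlog (((avgIter L U₀ (K - dep i) (pt i) (dir i) *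
          (pullIter L (avgIter L U₀ K) (dep i) (pt i) (dir i))⁻¹ : 𝔸ˣ) : 𝔸))))).restrictScalars ℝ : (X → 𝔸) →ₗ[ℝ] 𝒴))
    (fun _ => rfl) (fun _ => rfl) y
  subst hHf
  rw [supSize_κ] at h190
  exact norm_bH322_le_of_ineq190_layer boxB blkB dep pt dir box blk h190 hK hd hrow hτ hστ y hL hd1 hAG K hU₀ hB₃ hε1 hs3
    hs2 hs lo hi hlohi h317 h15 hX hfar hmv hα hα3 hα4 h52 q κ hgeom hCB hflow hRR hbox hβ₀ hε hsmall hc₃ hsm h1 hL1 hsO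

/-- **p. 250, `|U₁U_{1,□′}⁻¹ − 1| ≤ O(1)B₃e^{−δLM₂R₁}·44d²B₃ε₁`, END TO END FROM [15] SECT. G WITH INPUT AND OUTPUT SIZES
CONCRETE** — r11's `B14From190LayerSizes.dev119_le_of_ineq190_layer` (`k = 0`; the (1.18)/(3.17)-type field of `U₀` on a tower of
`K` levels) for the presented chart, with `h190`, `hmv` SUPPLIED by r08's `B11Ineq190Actual.ineq190_and_hmv_supSize_sectG` on
`X → 𝔸`, `hBloc` by §0. [cite: Balaban1988Convergent, (1.18)–(1.19) p.250, (3.17) p.268; Balaban1985Variational, Prop. 9 (190) pp.308–309, (179)–(180) p.306] -/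
theorem dev119_le_layer_sectG (Reg : Regime 𝒢 0 W B₀ θ C₄ a₃ j a ε₄) (hWa : AnalyticOnNhd ℂ W {Y : 𝒴 | ‖Y‖ < a₃})
    {D : 𝒴 → X → 𝔸} (H : (X → 𝔸) →L[ℂ] 𝒴) (hTm : AnalyticOnNhd ℂ (fun Y : 𝒴 => Y - H (D Y)) {Y : 𝒴 | ‖Y‖ < ε₄ + a})
    (hTm0 : (0 : 𝒴) - H (D 0) = 0)
    (dep : X → ℕ) (pt : X → B7Prop1Explicit.Site d) (dir : X → Fin d)
    {L : ℕ} (hL : 2 ≤ L) (hd1 : 1 ≤ d) {G : Subgroup 𝔸ˣ} (hAG : AvgClosed d L G) (K : ℕ)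
    {U₀ : B7Prop1Explicit.Site d → Fin d → 𝔸ˣ} (hU₀ : ∀ x κ, U₀ x κ ∈ G)
    (hB : ‖H₀ (fun i => mlog (((avgIter L U₀ (K - dep i) (pt i) (dir i) *
          (pullIter L (avgIter L U₀ K) (dep i) (pt i) (dir i))⁻¹ : 𝔸ˣ) : 𝔸)))‖ < a ∧
      ‖D2 (H₀ (fun i => mlog (((avgIter L U₀ (K - dep i) (pt i) (dir i) *
          (pullIter L (avgIter L U₀ K) (dep i) (pt i) (dir i))⁻¹ : 𝔸ˣ) : 𝔸))))‖ < j)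
    (boxB : g.Site → Finset X) (blkB : X → g.Site) (hcover : ∀ i, i ∈ boxB (blkB i))
    (box : g.Site → Finset (B7Prop1Explicit.Site d)) (blk : B7Prop1Explicit.Site d → g.Site)
    (ev : B7Prop1Explicit.Site d → (𝒴 →L[ℝ] (Fin d → 𝔸)))
    {bN : BlockNorm g 𝒴} {b3 : BlockNorm g 𝒵}
    (hev : ∀ (y : g.Site) (v : 𝒴), ∀ x ∈ box y, ‖ev x v‖ ≤ bN.loc y v)
    (hN : ∀ (y : g.Site) (v : 𝒴), bN.loc y v ≤ ‖v‖)
    {δ₀ BG θW cΔ A₀ AH θD c : ℝ}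
    (htri : Triangle254 g) (hd : ∀ a b : g.Site, 0 ≤ g.dist a b) (hδ₀ : 0 ≤ δ₀)
    (hc : 0 ≤ c) (hBG : 0 ≤ BG) (hθW : 0 ≤ θW) (hcΔ : 0 ≤ cΔ) (hA₀ : 0 ≤ A₀) (hAH : 0 ≤ AH) (hθD : 0 ≤ θD)
    (hG : HasMaj b3 bN (𝒢.restrictScalars ℝ : 𝒵 →ₗ[ℝ] 𝒴) (fun y y' => BG * Real.exp (-(δ₀ * g.dist y y'))))
    (hD2H0 : HasMaj (supSize (X := X) (E := 𝔸) g boxB blkB) b3 ((D2 ∘L H₀).restrictScalars ℝ : (X → 𝔸) →ₗ[ℝ] 𝒵)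
      (fun y y' => cΔ * Real.exp (-(δ₀ * g.dist y y'))))
    (hH0 : HasMaj (supSize (X := X) (E := 𝔸) g boxB blkB) bN (H₀.restrictScalars ℝ : (X → 𝔸) →ₗ[ℝ] 𝒴)
      (fun y y' => A₀ * Real.exp (-(δ₀ * g.dist y y'))))
    (hH : HasMaj (supSize (X := X) (E := 𝔸) g boxB blkB) bN (H.restrictScalars ℝ : (X → 𝔸) →ₗ[ℝ] 𝒴)
      (fun y y' => AH * Real.exp (-(δ₀ / 2 * g.dist y y'))))
    (h189 : ∀ B' : X → 𝔸, ‖H₀ B'‖ < a → ‖D2 (H₀ B')‖ < j →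
      Ineq189 bN b3 ((fderiv ℂ W (solA180 𝒢 W D2 H₀ ε₄ B' + H₀ B')).restrictScalars ℝ : 𝒴 →ₗ[ℝ] 𝒵) θW δ₀)
    (hDfr : ∀ B' : X → 𝔸, ‖H₀ B'‖ < a → ‖D2 (H₀ B')‖ < j →
      ∃ 𝔇 : 𝒴 →L[ℂ] (X → 𝔸), HasFDerivAt D 𝔇 (solA180 𝒢 W D2 H₀ ε₄ B' + H₀ B') ∧
        HasMaj bN (supSize (X := X) (E := 𝔸) g boxB blkB) (𝔇.restrictScalars ℝ : 𝒴 →ₗ[ℝ] (X → 𝔸))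
          (fun y y' => θD * Real.exp (-(δ₀ / 2 * g.dist y y'))))
    (hq : qG b3.κ bN.κ BG θW c < 1)
    -- the [III] side: the letters of `B14From190LayerSizes.dev119_le_of_ineq190_layer` minus `h190`, `hmv`
    {σ τ Dd : ℝ} (hrow : RowSum g σ c) (hτ : 0 ≤ τ) (hστ : σ + τ ≤ δ₀ / 8) (y : g.Site)
    {B₃ δ M₂ R₁ ε₁ : ℝ} (hB₃ : 0 < B₃) (hε1 : 0 < ε₁)
    (hs3 : C0 d * (2 * B₃ * ε₁) ≤ 1 / 3) (hs2 : 2 * (2 * B₃ * ε₁) ≤ c2' d L)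
    (hs : 11 * (d : ℝ) ^ 2 * (2 * B₃ * ε₁) ≤ 1 / 6) (lo hi : B7Prop1Explicit.Site d) (hlohi : lo ≤ hi)
    (h317 : pdevOn (tlo L lo K) (thi L hi K) U₀ < 2 * B₃ * ε₁ * (((L : ℝ) ^ K)⁻¹) ^ 2)
    (h15 : ∀ n, n < K → ∀ z, tlo L lo n ≤ z → z ≤ thi L hi n → ∀ r : Fin d → Fin L,
      axialFn (avgIter L U₀ (K - (n + 1))) ((L : ℤ) • z) ((L : ℤ) • z + boxVec L r) = 1)
    (hX : ∀ i, dep i ≤ K ∧ tlo L lo (dep i) ≤ pt i ∧ pt i + e (dir i) ≤ thi L hi (dep i))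
    (hfar : ∀ y' i, i ∈ boxB y' → Dd ≤ g.dist y y')
    {Hf : B7Prop1Explicit.Site d → Fin d → 𝔸}
    (hHf : Hf = fun x => ev x (chartH179 𝒢 W D2 H₀ (fun Y : 𝒴 => Y - H (D Y)) ε₄
      (fun i => mlog (((avgIter L U₀ (K - dep i) (pt i) (dir i) *
          (pullIter L (avgIter L U₀ K) (dep i) (pt i) (dir i))⁻¹ : 𝔸ˣ) : 𝔸)))))
    {α₀ : ℝ} (hα : 0 < α₀)
    (hα3 : C0 d * α₀ ≤ 1 / 3) (hα4 : 4 * α₀ ≤ c2' d L) (h52 : pdev U₀ < α₀ * (((L : ℝ) ^ 0)⁻¹) ^ 2)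
    (q : B7Prop1Explicit.Site d) (κ : Fin d)
    (hgeom : δ * L * M₂ * R₁ ≤ τ * Dd) (hCB : const190 1 bN.κ b3.κ BG θW cΔ A₀ AH θD c * c ≤ B₃)
    (hbox : ∀ y', B7Prop1Local.InBox (B7Prop1Local.loK L 0 q) (B7Prop1Local.bondHiK L 0 q κ) y' → y' ∈ box y)
    (hsmall : Real.exp (4 * (800 * ((d : ℝ) + 1) ^ 2 * ((d : ℝ) + 4)) * α₀)
      * (1 + 8 * (131072 * ((d : ℝ) + 1) ^ 2) * (B₃ * Real.exp (-(δ * L * M₂ * R₁)) * (44 * (d : ℝ) ^ 2 * B₃) * ε₁)) ≤ 2)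
    (hc₃ : 2 * (B₃ * Real.exp (-(δ * L * M₂ * R₁)) * (44 * (d : ℝ) ^ 2 * B₃) * ε₁) ≤ c3 d L)
    (hsm : 2048 * (d : ℝ) * (B₃ * Real.exp (-(δ * L * M₂ * R₁)) * (44 * (d : ℝ) ^ 2 * B₃) * ε₁) ≤ 1)
    (h1 : 128 * (B₃ * Real.exp (-(δ * L * M₂ * R₁)) * (44 * (d : ℝ) ^ 2 * B₃) * ε₁) ≤ 1) (hL1 : 1 ≤ L) :
    ‖((avgIter L
          (gaugeAct (B7Eq84Concrete.glev L hL1 U₀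
              (expCfg (fun z μ => ((Complex.I : ℂ) * ((((L : ℝ) ^ (0 + 1))⁻¹ : ℝ) : ℂ)) • Hf z μ)) 0 0)⁻¹
            (expCfg (fun z μ => ((Complex.I : ℂ) * ((((L : ℝ) ^ (0 + 1))⁻¹ : ℝ) : ℂ)) • Hf z μ) * U₀)) 0 q κ : 𝔸ˣ) : 𝔸)
        * (((avgIter L U₀ 0 q κ)⁻¹ : 𝔸ˣ) : 𝔸) - 1‖
      ≤ (68 * ((d : ℝ) + 1) + 160 * d) * (B₃ * Real.exp (-(δ * L * M₂ * R₁)) * (44 * (d : ℝ) ^ 2 * B₃) * ε₁) := by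
  have hrow8 : RowSum g (δ₀ / 8) c := hrow.mono hd (by linarith)
  have hK : 0 ≤ const190 1 bN.κ b3.κ BG θW cΔ A₀ AH θD c :=
    const190_nonneg' zero_le_one bN.κ_nonneg b3.κ_nonneg hc hBG hθW hcΔ hA₀ hAH hθD hq
  have hBloc : ∀ (y' : g.Site) (μ : X → 𝔸), (supSize (X := X) (E := 𝔸) g boxB blkB).IsLoc y' μ →
      ‖μ‖ ≤ (supSize (X := X) (E := 𝔸) g boxB blkB).loc y' μ := fun y' μ hμ => norm_le_loc_supSize_of_isLoc hcover hμ
  obtain ⟨h190, hmv⟩ := ineq190_and_hmv_supSize_sectG (box := box) (blk := blk) Reg hWa H hTm hTm0 hB ev hev hN hBloc htri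
    hd hδ₀ hrow8 hc hBG hθW hcΔ hA₀ hAH hθD hG hD2H0 hH0 hH h189 hDfr hq
    (fun B' => fun x => ev x (chartH179 𝒢 W D2 H₀ (fun Y : 𝒴 => Y - H (D Y)) ε₄ B'))
    (fun t => (LinearMap.pi fun x => ((ev x : 𝒴 →L[ℝ] (Fin d → 𝔸)) : 𝒴 →ₗ[ℝ] (Fin d → 𝔸))) ∘ₗ
      ((fderiv ℂ (chartH179 𝒢 W D2 H₀ (fun Y : 𝒴 => Y - H (D Y)) ε₄) ((t : ℝ) •
        (fun i => mlog (((avgIter L U₀ (K - dep i) (pt i) (dir i) *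
          (pullIter L (avgIter L U₀ K) (dep i) (pt i) (dir i))⁻¹ : 𝔸ˣ) : 𝔸))))).restrictScalars ℝ : (X → 𝔸) →ₗ[ℝ] 𝒴))
    (fun _ => rfl) (fun _ => rfl) y
  subst hHf
  rw [supSize_κ] at h190
  exact dev119_le_of_ineq190_layer boxB blkB dep pt dir box blk h190 hK hd hrow hτ hστ y hL hd1 hAG K hU₀ hB₃ hε1 hs3 hs2
    hs lo hi hlohi h317 h15 hX hfar hmv hα hα3 hα4 h52 q κ hgeom hCB hbox hsmall hc₃ hsm h1 hL1

end NormedAlgebra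

section CStar

variable {𝔸 : Type} [CStarAlgebra 𝔸] [Nontrivial 𝔸]
  {𝒢 : 𝒵 →L[ℂ] 𝒴} {W : 𝒴 → 𝒵} {D2 : 𝒴 →L[ℂ] 𝒵} {H₀ : (X → 𝔸) →L[ℂ] 𝒴} {B₀ θ C₄ a₃ j a ε₄ : ℝ}

/-- **(3.8) AT PRINT'S SCALE `η = L^{−k}`, END TO END FROM [15] SECT. G WITH ALL FOUR SIZES CONCRETE** — r11's
`B14From190LayerSizes.ineq38_lt_of_ineq190_layer_scale` (argument field `B :=` p29's (3.6) tower field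
`i ↦ (1/i)log[(Q^{s*}_jV)(b_i)(M^{k−j}(U₀)(b_i))⁻¹]`, split by depth into print's `4δ_k` / `30d²L²B₃(1+β₀)ε_k` pieces there; input
size `supSize gB boxB blkB`; output sizes `supSize gB box blk` and `covDerivBlockSize gB y₀ S L^{−k} U₀`; the (3.2) hypothesis `h32`
sizing the field AND bounding the consumer's plaquette) for the presented chart `𝐇 = x ↦ ev x (𝓗(B))`, with `h190₀`/`hmv₀` SUPPLIED
by r08's `B11Ineq190Actual.ineq190_and_hmv_supSize_sectG`, `h190₁` by p29's `B11Presentation190.ineq190_presentation_chartH179` ∘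
r08's `ineq190_sectG_dom`, `hmv₁` by p29's `hmv_covDerivBlockSize_chartH179`, and `hBloc` by §0.
[cite: Balaban1988Convergent, (3.2)–(3.3) p.265, (3.6)–(3.8) p.266; Balaban1985Variational, Prop. 9 (190) pp.308–309, (179)–(180) p.306, (115) p.294] -/
theorem ineq38_lt_layer_sectG (Reg : Regime 𝒢 0 W B₀ θ C₄ a₃ j a ε₄) (hWa : AnalyticOnNhd ℂ W {Y : 𝒴 | ‖Y‖ < a₃})
    {D : 𝒴 → X → 𝔸} (H : (X → 𝔸) →L[ℂ] 𝒴) (hTm : AnalyticOnNhd ℂ (fun Y : 𝒴 => Y - H (D Y)) {Y : 𝒴 | ‖Y‖ < ε₄ + a})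
    (hTm0 : (0 : 𝒴) - H (D 0) = 0)
    -- p29's (3.6) tower: background `U₀`, top field `V`, and its field `B`, which must lie in the domain of (180)
    (dep : X → ℕ) (pt : X → B7Prop1Explicit.Site d) (dir : X → Fin d)
    {L : ℕ} {k : ℕ} {U₀ : B7Prop1Explicit.Site d → Fin d → 𝔸ˣ} (V : B7Prop1Explicit.Site d → Fin d → 𝔸ˣ)
    (hB : ‖H₀ (fun i => mlog (((pullIter L V (dep i) (pt i) (dir i) *
          (avgIter L U₀ (k - dep i) (pt i) (dir i))⁻¹ : 𝔸ˣ) : 𝔸)))‖ < a ∧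
      ‖D2 (H₀ (fun i => mlog (((pullIter L V (dep i) (pt i) (dir i) *
          (avgIter L U₀ (k - dep i) (pt i) (dir i))⁻¹ : 𝔸ˣ) : 𝔸))))‖ < j)
    -- sizes and presentation
    {gB : B6.Geometry} (boxB : gB.Site → Finset X) (blkB : X → gB.Site) (hcover : ∀ i, i ∈ boxB (blkB i))
    (box : gB.Site → Finset (B7Prop1Explicit.Site d)) (blk : B7Prop1Explicit.Site d → gB.Site)
    (y₀ : gB.Site) (S : gB.Site → Finset (B7Prop1Explicit.Site d × Fin d × Fin d))
    (ev : B7Prop1Explicit.Site d → (𝒴 →L[ℝ] (Fin d → 𝔸)))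
    {bN : BlockNorm gB 𝒴} {b3 : BlockNorm gB 𝒵}
    (hev : ∀ (y : gB.Site) (v : 𝒴), ∀ x ∈ box y, ‖ev x v‖ ≤ bN.loc y v)
    (hev₁ : ∀ (y : gB.Site) (v : 𝒴), (covDerivBlockSize gB y₀ S (((L : ℝ) ^ k)⁻¹) U₀).loc y (fun x => ev x v) ≤ bN.loc y v)
    (hN : ∀ (y : gB.Site) (v : 𝒴), bN.loc y v ≤ ‖v‖)
    -- the located leaves of [15] Sect. G (r08's letters), input size `supSize gB boxB blkB`
    {δ₀ BG θW cΔ A₀ AH θD c : ℝ}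
    (htri : Triangle254 gB) (hd : ∀ a b : gB.Site, 0 ≤ gB.dist a b) (hδ₀ : 0 ≤ δ₀)
    (hc : 0 ≤ c) (hBG : 0 ≤ BG) (hθW : 0 ≤ θW) (hcΔ : 0 ≤ cΔ) (hA₀ : 0 ≤ A₀) (hAH : 0 ≤ AH) (hθD : 0 ≤ θD)
    (hG : HasMaj b3 bN (𝒢.restrictScalars ℝ : 𝒵 →ₗ[ℝ] 𝒴) (fun y y' => BG * Real.exp (-(δ₀ * gB.dist y y'))))
    (hD2H0 : HasMaj (supSize (X := X) (E := 𝔸) gB boxB blkB) b3 ((D2 ∘L H₀).restrictScalars ℝ : (X → 𝔸) →ₗ[ℝ] 𝒵)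
      (fun y y' => cΔ * Real.exp (-(δ₀ * gB.dist y y'))))
    (hH0 : HasMaj (supSize (X := X) (E := 𝔸) gB boxB blkB) bN (H₀.restrictScalars ℝ : (X → 𝔸) →ₗ[ℝ] 𝒴)
      (fun y y' => A₀ * Real.exp (-(δ₀ * gB.dist y y'))))
    (hH : HasMaj (supSize (X := X) (E := 𝔸) gB boxB blkB) bN (H.restrictScalars ℝ : (X → 𝔸) →ₗ[ℝ] 𝒴)
      (fun y y' => AH * Real.exp (-(δ₀ / 2 * gB.dist y y'))))
    (h189 : ∀ B' : X → 𝔸, ‖H₀ B'‖ < a → ‖D2 (H₀ B')‖ < j →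
      Ineq189 bN b3 ((fderiv ℂ W (solA180 𝒢 W D2 H₀ ε₄ B' + H₀ B')).restrictScalars ℝ : 𝒴 →ₗ[ℝ] 𝒵) θW δ₀)
    (hDfr : ∀ B' : X → 𝔸, ‖H₀ B'‖ < a → ‖D2 (H₀ B')‖ < j →
      ∃ 𝔇 : 𝒴 →L[ℂ] (X → 𝔸), HasFDerivAt D 𝔇 (solA180 𝒢 W D2 H₀ ε₄ B' + H₀ B') ∧
        HasMaj bN (supSize (X := X) (E := 𝔸) gB boxB blkB) (𝔇.restrictScalars ℝ : 𝒴 →ₗ[ℝ] (X → 𝔸))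
          (fun y y' => θD * Real.exp (-(δ₀ / 2 * gB.dist y y'))))
    (hq : qG b3.κ bN.κ BG θW c < 1)
    -- the [III] side: the letters of `B14From190LayerSizes.ineq38_lt_of_ineq190_layer_scale` minus `h190₀,₁`, `hmv₀,₁`
    {σ τ Dd B₃ δ M₂ R δk β₀ A₀' A₁ εk εk1 : ℝ}
    (hrow : RowSum gB σ c) (hτ : 0 ≤ τ) (hστ : σ + τ ≤ δ₀ / 8) (y : gB.Site)
    (hL : 2 ≤ L) (hd1 : 1 ≤ d) {G : Subgroup 𝔸ˣ} (hAG : AvgClosed d L G)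
    (hU₀ : ∀ x κ, U₀ x κ ∈ G) (hε : 0 < εk) (hε' : 0 < εk1) (hflow : εk1 ≤ (1 + β₀) * εk) (hβ₀ : 0 ≤ β₀)
    (hB₃ : 1 ≤ B₃) (hδ0 : 0 ≤ δk) (hδε : δk ≤ εk)
    (hs3 : C0 d * εk1 ≤ 1 / 3) (hs2 : 2 * εk1 ≤ c2' d L) (hs : 2 * δk + 11 * (d : ℝ) ^ 2 * εk1 ≤ 1 / 6)
    (lo hi : B7Prop1Explicit.Site d) (hlohi : lo ≤ hi)
    (h32 : pdevOn (tlo L lo k) (thi L hi k) U₀ < εk1 * ((L : ℝ)⁻¹ * ((L : ℝ) ^ k)⁻¹) ^ 2)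
    (hV : ∀ x μ, V x μ ∈ U1 𝔸)
    (h15 : ∀ n, n < k → ∀ z, tlo L lo n ≤ z → z ≤ thi L hi n → ∀ r : Fin d → Fin L,
      axialFn (avgIter L U₀ (k - (n + 1))) ((L : ℤ) • z) ((L : ℤ) • z + boxVec L r) = 1)
    (hδ2 : 2 * δk ≤ 1 / 2)
    (h33 : ∀ x ν, lo ≤ x → x + e ν ≤ hi → ‖((V x ν * (avgIter L U₀ k x ν)⁻¹ : 𝔸ˣ) : 𝔸) - 1‖ < 2 * δk)
    (hX : ∀ i, dep i ≤ k ∧ tlo L lo (dep i) ≤ pt i ∧ pt i + e (dir i) ≤ thi L hi (dep i))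
    (hfar : ∀ y' i, i ∈ boxB y' → dep i ≠ 0 → Dd ≤ gB.dist y y')
    {Hf : B7Prop1Explicit.Site d → Fin d → 𝔸}
    (hHf : Hf = fun x => ev x (chartH179 𝒢 W D2 H₀ (fun Y : 𝒴 => Y - H (D Y)) ε₄
      (fun i => mlog (((pullIter L V (dep i) (pt i) (dir i) *
          (avgIter L U₀ (k - dep i) (pt i) (dir i))⁻¹ : 𝔸ˣ) : 𝔸)))))
    (hsa : ∀ z κ, IsSelfAdjoint (Hf z κ))
    {u : B7Prop1Explicit.Site d → 𝔸ˣ} (hu : ∀ z, u z ∈ U1 𝔸) (μ ν : Fin d) (x : B7Prop1Explicit.Site d)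
    (hgeom : 2 * δ * M₂ * R ≤ τ * Dd) (hCB : const190 1 bN.κ b3.κ BG θW cΔ A₀ AH θD c * c ≤ B₃)
    (hδkε : δk = A₁ / A₀' * εk) (hM : 1 ≤ 2 * δ * M₂) (hR : 0 ≤ R)
    (h10 : 4 * B₃ * A₁ / A₀' + 30 * (d : ℝ) ^ 2 * (L : ℝ) ^ 2 * B₃ ^ 2 * (1 + β₀) * Real.exp (-R) < 1/10)
    (hx : x ∈ box y) (hxμ : x + e μ ∈ box y) (hxν : x + e ν ∈ box y)
    (hS₁ : (x, μ, ν) ∈ S y) (hS₂ : (x, ν, μ) ∈ S y)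
    (hε1 : εk ≤ 1) (hrestr : 2 * (1 + β₀) * (L : ℝ)⁻¹ ^ 2 + 4/10 < 1)
    (hp : PlaqIn (tlo L lo k) (thi L hi k) (x, μ, ν)) :
    ‖B8Ineq132.plaqF (gaugeAct u (B8Lemma1NonAbelian.mulCfg (B8Eq146AExpansion.expCfg
        (B8Eq146AExpansion.iEta (((L : ℝ) ^ k)⁻¹) Hf)) U₀)) μ ν x - 1‖ < εk * (((L : ℝ) ^ k)⁻¹) ^ 2 := by
  have hrow8 : RowSum gB (δ₀ / 8) c := hrow.mono hd (by linarith)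
  have hK : 0 ≤ const190 1 bN.κ b3.κ BG θW cΔ A₀ AH θD c :=
    const190_nonneg' zero_le_one bN.κ_nonneg b3.κ_nonneg hc hBG hθW hcΔ hA₀ hAH hθD hq
  have hBloc : ∀ (y' : gB.Site) (μ : X → 𝔸), (supSize (X := X) (E := 𝔸) gB boxB blkB).IsLoc y' μ →
      ‖μ‖ ≤ (supSize (X := X) (E := 𝔸) gB boxB blkB).loc y' μ := fun y' μ hμ => norm_le_loc_supSize_of_isLoc hcover hμ
  -- values: r08's end-to-end pair
  obtain ⟨h190₀, hmv₀⟩ := ineq190_and_hmv_supSize_sectG (box := box) (blk := blk) Reg hWa H hTm hTm0 hB ev hev hN hBloc htri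
    hd hδ₀ hrow8 hc hBG hθW hcΔ hA₀ hAH hθD hG hD2H0 hH0 hH h189 hDfr hq
    (fun B' => fun x => ev x (chartH179 𝒢 W D2 H₀ (fun Y : 𝒴 => Y - H (D Y)) ε₄ B'))
    (fun t => (LinearMap.pi fun x => ((ev x : 𝒴 →L[ℝ] (Fin d → 𝔸)) : 𝒴 →ₗ[ℝ] (Fin d → 𝔸))) ∘ₗ
      ((fderiv ℂ (chartH179 𝒢 W D2 H₀ (fun Y : 𝒴 => Y - H (D Y)) ε₄) ((t : ℝ) •
        (fun i => mlog (((pullIter L V (dep i) (pt i) (dir i) *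
          (avgIter L U₀ (k - dep i) (pt i) (dir i))⁻¹ : 𝔸ˣ) : 𝔸))))).restrictScalars ℝ : (X → 𝔸) →ₗ[ℝ] 𝒴))
    (fun _ => rfl) (fun _ => rfl) y
  -- covariant derivatives: (190) on `𝒴` on the domain of (180) (r08), presented into the first-order size (p29), `hmv₁` (p29)
  have h190Y := ineq190_sectG_dom Reg hWa H hN hBloc htri hd hδ₀ hrow8 hc hBG hθW hcΔ hA₀ hAH hθD hG hD2H0 hH0 hH h189 hDfr hq
  have h190₁ := ineq190_presentation_chartH179 (b₃ := covDerivBlockSize gB y₀ S (((L : ℝ) ^ k)⁻¹) U₀) hB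
    (LinearMap.pi fun x => ((ev x : 𝒴 →L[ℝ] (Fin d → 𝔸)) : 𝒴 →ₗ[ℝ] (Fin d → 𝔸))) (fun y' v => hev₁ y' v) h190Y
    (fun t => (LinearMap.pi fun x => ((ev x : 𝒴 →L[ℝ] (Fin d → 𝔸)) : 𝒴 →ₗ[ℝ] (Fin d → 𝔸))) ∘ₗ
      ((fderiv ℂ (chartH179 𝒢 W D2 H₀ (fun Y : 𝒴 => Y - H (D Y)) ε₄) ((t : ℝ) •
        (fun i => mlog (((pullIter L V (dep i) (pt i) (dir i) *
          (avgIter L U₀ (k - dep i) (pt i) (dir i))⁻¹ : 𝔸ˣ) : 𝔸))))).restrictScalars ℝ : (X → 𝔸) →ₗ[ℝ] 𝒴))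
    (fun _ => rfl)
  have hmv₁ := hmv_covDerivBlockSize_chartH179 (y₀ := y₀) (S := S) (ξ := ((L : ℝ) ^ k)⁻¹) (U₀ := U₀) Reg hWa hTm hTm0 ev
    (fun B' => fun x => ev x (chartH179 𝒢 W D2 H₀ (fun Y : 𝒴 => Y - H (D Y)) ε₄ B'))
    (fun t => (LinearMap.pi fun x => ((ev x : 𝒴 →L[ℝ] (Fin d → 𝔸)) : 𝒴 →ₗ[ℝ] (Fin d → 𝔸))) ∘ₗ
      ((fderiv ℂ (chartH179 𝒢 W D2 H₀ (fun Y : 𝒴 => Y - H (D Y)) ε₄) ((t : ℝ) •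
        (fun i => mlog (((pullIter L V (dep i) (pt i) (dir i) *
          (avgIter L U₀ (k - dep i) (pt i) (dir i))⁻¹ : 𝔸ˣ) : 𝔸))))).restrictScalars ℝ : (X → 𝔸) →ₗ[ℝ] 𝒴))
    hB (fun _ => rfl) (fun _ _ => rfl) y
  subst hHf
  rw [supSize_κ] at h190₀ h190₁
  exact ineq38_lt_of_ineq190_layer_scale boxB blkB dep pt dir box blk y₀ S h190₀ h190₁ hK hd hrow hτ hστ y hL hd1 hAG hU₀ hε
    hε' hflow hβ₀ hB₃ hδ0 hδε hs3 hs2 hs lo hi hlohi h32 V hV h15 hδ2 h33 hX hfar hsa hu μ ν x hmv₀ hmv₁ hgeom hCB hδkε hM hR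
    h10 hx hxμ hxν hS₁ hS₂ hε1 hrestr hp

end CStar

end LayerLevel

/-! ## §3 The Sect. C letters from [15] Proposition 3 (r08's `B11Ineq190FromProp3`) -/

section OfInputs

variable {X : Type} [Fintype X]
variable {𝒴 𝒵 : Type} [NormedAddCommGroup 𝒴] [NormedSpace ℂ 𝒴] [NormedAddCommGroup 𝒵] [NormedSpace ℂ 𝒵]
  [CompleteSpace 𝒴] [CompleteSpace 𝒵] {g : B6.Geometry}
variable {𝔸 : Type} [NormedRing 𝔸] [NormedAlgebra ℂ 𝔸] [CompleteSpace 𝔸] [NormOneClass 𝔸]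
  {𝒢 : 𝒵 →L[ℂ] 𝒴} {W : 𝒴 → 𝒵} {D2 : 𝒴 →L[ℂ] 𝒵} {H₀ : (X → 𝔸) →L[ℂ] 𝒴} {B₀ θ C₄ a₃ j a ε₄ : ℝ}
  {C : 𝒴 → X → 𝔸} {H : (X → 𝔸) →L[ℂ] 𝒴} {C₂ C₃ B₀' c₄ ε₃ : ℝ}

/-- **(3.19) `< δ_k`, END TO END FROM [15] SECT. G AND PROPOSITION 3, INPUT AND OUTPUT SIZES CONCRETE** — §2's
`ineq319_lt_layer_sectG` with the Sect. C transformation `Tm = · − H(D ·)` taken at `D := B11Prop3Model.Dfix C H C₂` (THE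
solution of [15] (49)): its three letters `hTm` (analytic), `hTm0` (`Tm 0 = 0`) and the differentiability half of `hDfr` are
r08's theorems from Proposition 3's inputs (44)/(46)/(72) (`B11Prop3Model.Inputs C H C₂ C₃ B₀′ c₄`), the analyticity of `C`, the
printed smallness `18C₂B₀′ε₃ ≤ 1`, `2ε₃ ≤ c₄` and the nesting `ε₄ + a ≤ ε₃` (`B11Ineq190FromProp3.ineq190_and_hmv_supSize_of_inputs`);
the (73) letter is the decay majorant `h73` of the actual derivative of `Dfix`.
[cite: Balaban1988Convergent, (3.17)–(3.19) p.268; Balaban1985Variational, Prop. 9 (190) pp.308–309, Prop. 3 p.289, (179)–(180) p.306] -/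
theorem ineq319_lt_layer_of_inputs (Reg : Regime 𝒢 0 W B₀ θ C₄ a₃ j a ε₄) (hWa : AnalyticOnNhd ℂ W {Y : 𝒴 | ‖Y‖ < a₃})
    (hin : Inputs C (H : (X → 𝔸) →ₗ[ℂ] 𝒴) C₂ C₃ B₀' c₄) (hCa : AnalyticOnNhd ℂ C {Y : 𝒴 | ‖Y‖ < 2 * c₄})
    (hC₂ : 0 ≤ C₂) (hC₃ : 0 ≤ C₃) (hB₀' : 0 ≤ B₀') (hε₃ : 0 < ε₃) (h18 : 18 * C₂ * B₀' * ε₃ ≤ 1) (h2 : 2 * ε₃ ≤ c₄)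
    (hnest : ε₄ + a ≤ ε₃)
    (dep : X → ℕ) (pt : X → B7Prop1Explicit.Site d) (dir : X → Fin d)
    {L : ℕ} (hL : 2 ≤ L) (hd1 : 1 ≤ d) {G : Subgroup 𝔸ˣ} (hAG : AvgClosed d L G) (K : ℕ)
    {U₀ : B7Prop1Explicit.Site d → Fin d → 𝔸ˣ} (hU₀ : ∀ x κ, U₀ x κ ∈ G)
    (hB : ‖H₀ (fun i => mlog (((avgIter L U₀ (K - dep i) (pt i) (dir i) *
          (pullIter L (avgIter L U₀ K) (dep i) (pt i) (dir i))⁻¹ : 𝔸ˣ) : 𝔸)))‖ < a ∧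
      ‖D2 (H₀ (fun i => mlog (((avgIter L U₀ (K - dep i) (pt i) (dir i) *
          (pullIter L (avgIter L U₀ K) (dep i) (pt i) (dir i))⁻¹ : 𝔸ˣ) : 𝔸))))‖ < j)
    (boxB : g.Site → Finset X) (blkB : X → g.Site) (hcover : ∀ i, i ∈ boxB (blkB i))
    (box : g.Site → Finset (B7Prop1Explicit.Site d)) (blk : B7Prop1Explicit.Site d → g.Site)
    (ev : B7Prop1Explicit.Site d → (𝒴 →L[ℝ] (Fin d → 𝔸)))
    {bN : BlockNorm g 𝒴} {b3 : BlockNorm g 𝒵}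
    (hev : ∀ (y : g.Site) (v : 𝒴), ∀ x ∈ box y, ‖ev x v‖ ≤ bN.loc y v)
    (hN : ∀ (y : g.Site) (v : 𝒴), bN.loc y v ≤ ‖v‖)
    {δ₀ BG θW cΔ A₀ AH θD c : ℝ}
    (htri : Triangle254 g) (hd : ∀ a b : g.Site, 0 ≤ g.dist a b) (hδ₀ : 0 ≤ δ₀)
    (hc : 0 ≤ c) (hBG : 0 ≤ BG) (hθW : 0 ≤ θW) (hcΔ : 0 ≤ cΔ) (hA₀ : 0 ≤ A₀) (hAH : 0 ≤ AH) (hθD : 0 ≤ θD)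
    (hG : HasMaj b3 bN (𝒢.restrictScalars ℝ : 𝒵 →ₗ[ℝ] 𝒴) (fun y y' => BG * Real.exp (-(δ₀ * g.dist y y'))))
    (hD2H0 : HasMaj (supSize (X := X) (E := 𝔸) g boxB blkB) b3 ((D2 ∘L H₀).restrictScalars ℝ : (X → 𝔸) →ₗ[ℝ] 𝒵)
      (fun y y' => cΔ * Real.exp (-(δ₀ * g.dist y y'))))
    (hH0 : HasMaj (supSize (X := X) (E := 𝔸) g boxB blkB) bN (H₀.restrictScalars ℝ : (X → 𝔸) →ₗ[ℝ] 𝒴)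
      (fun y y' => A₀ * Real.exp (-(δ₀ * g.dist y y'))))
    (hH : HasMaj (supSize (X := X) (E := 𝔸) g boxB blkB) bN (H.restrictScalars ℝ : (X → 𝔸) →ₗ[ℝ] 𝒴)
      (fun y y' => AH * Real.exp (-(δ₀ / 2 * g.dist y y'))))
    (h189 : ∀ B' : X → 𝔸, ‖H₀ B'‖ < a → ‖D2 (H₀ B')‖ < j →
      Ineq189 bN b3 ((fderiv ℂ W (solA180 𝒢 W D2 H₀ ε₄ B' + H₀ B')).restrictScalars ℝ : 𝒴 →ₗ[ℝ] 𝒵) θW δ₀)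
    (h73 : ∀ B' : X → 𝔸, ‖H₀ B'‖ < a → ‖D2 (H₀ B')‖ < j →
      HasMaj bN (supSize (X := X) (E := 𝔸) g boxB blkB)
        ((fderiv ℂ (Dfix C (H : (X → 𝔸) →ₗ[ℂ] 𝒴) C₂) (solA180 𝒢 W D2 H₀ ε₄ B' + H₀ B')).restrictScalars ℝ :
          𝒴 →ₗ[ℝ] (X → 𝔸))
        (fun y y' => θD * Real.exp (-(δ₀ / 2 * g.dist y y'))))
    (hq : qG b3.κ bN.κ BG θW c < 1)
    -- the [III] side, as in §2
    {σ τ Dd : ℝ} (hrow : RowSum g σ c) (hτ : 0 ≤ τ) (hστ : σ + τ ≤ δ₀ / 8) (y : g.Site)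
    {B₃ δ M₂ R1 R β₀ A₀' A₁ ε εk1 δk : ℝ} (hB₃ : 0 < B₃) (hε1 : 0 < εk1)
    (hs3 : C0 d * (2 * B₃ * εk1) ≤ 1 / 3) (hs2 : 2 * (2 * B₃ * εk1) ≤ c2' d L)
    (hs : 11 * (d : ℝ) ^ 2 * (2 * B₃ * εk1) ≤ 1 / 6) (lo hi : B7Prop1Explicit.Site d) (hlohi : lo ≤ hi)
    (h317 : pdevOn (tlo L lo K) (thi L hi K) U₀ < 2 * B₃ * εk1 * (((L : ℝ) ^ K)⁻¹) ^ 2)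
    (h15 : ∀ n, n < K → ∀ z, tlo L lo n ≤ z → z ≤ thi L hi n → ∀ r : Fin d → Fin L,
      axialFn (avgIter L U₀ (K - (n + 1))) ((L : ℤ) • z) ((L : ℤ) • z + boxVec L r) = 1)
    (hX : ∀ i, dep i ≤ K ∧ tlo L lo (dep i) ≤ pt i ∧ pt i + e (dir i) ≤ thi L hi (dep i))
    (hfar : ∀ y' i, i ∈ boxB y' → Dd ≤ g.dist y y')
    {Hf : B7Prop1Explicit.Site d → Fin d → 𝔸}
    (hHf : Hf = fun x => ev x (chartH179 𝒢 W D2 H₀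
      (fun Y : 𝒴 => Y - H (Dfix C (H : (X → 𝔸) →ₗ[ℂ] 𝒴) C₂ Y)) ε₄
      (fun i => mlog (((avgIter L U₀ (K - dep i) (pt i) (dir i) *
          (pullIter L (avgIter L U₀ K) (dep i) (pt i) (dir i))⁻¹ : 𝔸ˣ) : 𝔸)))))
    {k : ℕ} {α₀ : ℝ} (hα : 0 < α₀)
    (hα3 : C0 d * α₀ ≤ 1 / 3) (hα4 : 4 * α₀ ≤ c2' d L) (h52 : pdev U₀ < α₀ * (((L : ℝ) ^ k)⁻¹) ^ 2)
    (q : B7Prop1Explicit.Site d) (κ : Fin d)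
    (hgeom : δ * L * M₂ * R1 ≤ τ * Dd) (hCB : const190 1 bN.κ b3.κ BG θW cΔ A₀ AH θD c * c ≤ B₃)
    (hflow : εk1 ≤ (1 + β₀) * ε) (hRR : R ≤ δ * L * M₂ * R1)
    (hbox : ∀ y', B7Prop1Local.InBox (B7Prop1Local.loK L k q) (B7Prop1Local.bondHiK L k q κ) y' → y' ∈ box y)
    (hβ₀ : 0 ≤ 1 + β₀) (hε : 0 ≤ ε) (hδk : 0 < δk) (hεδ : ε = A₀' / A₁ * δk)
    (hsmall : Real.exp (4 * (800 * ((d : ℝ) + 1) ^ 2 * ((d : ℝ) + 4)) * α₀)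
      * (1 + 8 * (131072 * ((d : ℝ) + 1) ^ 2) * (44 * (d : ℝ) ^ 2 * B₃ ^ 2 * (1 + β₀) * Real.exp (-R) * ε)) ≤ 2)
    (hc₃ : 2 * (44 * (d : ℝ) ^ 2 * B₃ ^ 2 * (1 + β₀) * Real.exp (-R) * ε) ≤ c3 d L)
    (hsm : 2048 * (d : ℝ) * (44 * (d : ℝ) ^ 2 * B₃ ^ 2 * (1 + β₀) * Real.exp (-R) * ε) ≤ 1)
    (h1 : 128 * (44 * (d : ℝ) ^ 2 * B₃ ^ 2 * (1 + β₀) * Real.exp (-R) * ε) ≤ 1)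
    (hgk : (68 * ((d : ℝ) + 1) + 160 * d) * 44 * (d : ℝ) ^ 2 * B₃ ^ 2 * (1 + β₀) * (A₀' / A₁) * Real.exp (-R) < 1)
    (hL1 : 1 ≤ L) :
    ‖((avgIter L
          (gaugeAct (B7Eq84Concrete.glev L hL1 U₀
              (expCfg (fun z μ => ((Complex.I : ℂ) * ((((L : ℝ) ^ (k + 1))⁻¹ : ℝ) : ℂ)) • Hf z μ)) k 0)⁻¹
            (expCfg (fun z μ => ((Complex.I : ℂ) * ((((L : ℝ) ^ (k + 1))⁻¹ : ℝ) : ℂ)) • Hf z μ) * U₀)) k q κ : 𝔸ˣ) : 𝔸)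
        * (((avgIter L U₀ k q κ)⁻¹ : 𝔸ˣ) : 𝔸) - 1‖ < δk := by
  have hrow8 : RowSum g (δ₀ / 8) c := hrow.mono hd (by linarith)
  have hK : 0 ≤ const190 1 bN.κ b3.κ BG θW cΔ A₀ AH θD c :=
    const190_nonneg' zero_le_one bN.κ_nonneg b3.κ_nonneg hc hBG hθW hcΔ hA₀ hAH hθD hq
  have hBloc : ∀ (y' : g.Site) (μ : X → 𝔸), (supSize (X := X) (E := 𝔸) g boxB blkB).IsLoc y' μ →
      ‖μ‖ ≤ (supSize (X := X) (E := 𝔸) g boxB blkB).loc y' μ := fun y' μ hμ => norm_le_loc_supSize_of_isLoc hcover hμ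
  obtain ⟨h190, hmv⟩ := ineq190_and_hmv_supSize_of_inputs (box := box) (blk := blk) Reg hWa hin hCa hC₂ hC₃ hB₀' hε₃ h18 h2
    hnest hB ev hev hN hBloc htri hd hδ₀ hrow8 hc hBG hθW hcΔ hA₀ hAH hθD hG hD2H0 hH0 hH h189 h73 hq
    (fun B' => fun x => ev x (chartH179 𝒢 W D2 H₀
      (fun Y : 𝒴 => Y - H (Dfix C (H : (X → 𝔸) →ₗ[ℂ] 𝒴) C₂ Y)) ε₄ B'))
    (fun t => (LinearMap.pi fun x => ((ev x : 𝒴 →L[ℝ] (Fin d → 𝔸)) : 𝒴 →ₗ[ℝ] (Fin d → 𝔸))) ∘ₗ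
      ((fderiv ℂ (chartH179 𝒢 W D2 H₀ (fun Y : 𝒴 => Y - H (Dfix C (H : (X → 𝔸) →ₗ[ℂ] 𝒴) C₂ Y)) ε₄) ((t : ℝ) •
        (fun i => mlog (((avgIter L U₀ (K - dep i) (pt i) (dir i) *
          (pullIter L (avgIter L U₀ K) (dep i) (pt i) (dir i))⁻¹ : 𝔸ˣ) : 𝔸))))).restrictScalars ℝ : (X → 𝔸) →ₗ[ℝ] 𝒴))
    (fun _ => rfl) (fun _ => rfl) y
  subst hHf
  rw [supSize_κ] at h190
  exact ineq319_lt_of_ineq190_layer boxB blkB dep pt dir box blk h190 hK hd hrow hτ hστ y hL hd1 hAG K hU₀ hB₃ hε1 hs3 hs2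
    hs lo hi hlohi h317 h15 hX hfar hmv hα hα3 hα4 h52 q κ hgeom hCB hflow hRR hbox hβ₀ hε hδk hεδ hsmall hc₃ hsm h1 hgk hL1

end OfInputs

end Literature.MathematicalPhysics.QuantumFieldTheory.Balaban1983to89.B14From190SectG

end
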